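import Summits.CriticalPhenomena.CardyFormulaZ2.Theses.CardySelfDualSegment
import Literature.Probability.Percolation.CornerPercolation
import Literature.Probability.Percolation.DiagonalBoxCrossing
import Literature.Probability.LatticeModels.ProdBernoulliIndependence
import Literature.Probability.Percolation.LongRangeKernelPercolationProofs
import HarnessLib

/-!
# Disproof of `UniformBoxCrossing` (stmt-CriticalPhenomena-5476) — findings

Crux (route `CardySelfDualSegment`, sub-problem `CardyFormulaZ2`):
`UniformBoxCrossing` = the box-crossing (RSW) bounds for the corner models `M_t`, `t ∈ [0,1]`,
drawn on `√2 ℤ²`, with constants uniform in `t`: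
`∀ ρ > 0, ∃ c > 0, ∃ n₀, ∀ t, BoxCrossingBounds (cornerPercolation t) squareLatticeEmbedding.z ρ c n₀`
(`uniformBoxCrossing_iff`, definitional). VERDICT after cycle 1: NO KILL inside `t ∈ [0,1]`; the
statement resists (numerics below); two structural facts are proved and filed under
`Theorems/UniformBoxCrossing/Negative/` (p-ids in the crux item notes).

Findings (all kernel-checked, no `sorry`):

* §0 `uniformBoxCrossing_iff` — the inlined `let` blocks are `cornerPercolation` verbatim.
* §1 TIGHTNESS of the eventual-in-`n` clause: `boxCrossingBounds_square_false_of_le_one` — for ANY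
  measure, any `ρ`, any `c > 0`, `BoxCrossingBounds μ squareLatticeEmbedding.z ρ c n₀` fails when
  `n₀ ≤ 1` (at `n = 1` the translate `w = -(11/10) i` of the unit-height strip contains no vertex of
  `√2 ℤ²`: the crossing event is empty). Every witness of the crux has `n₀ ≥ 2`
  (`two_le_of_boxCrossingBounds`); harmless for provers, fatal for restatements "for all `n ≥ 1`".
* §2 FKG IS LOAD-BEARING (`UniformBoxCrossingWithoutFKG`, `uniformBoxCrossing_false_without_FKG`):
  the corner family extends verbatim to splitting parameter `s ∈ [0,1]` (`extCornerPercolation s`;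
  the crux is `s = t/2 ≤ 1/2`, exactly the FKG range of the corner law). All of: translation
  invariance, diagonal symmetry, self-duality (dual = point reflection), EXACT `1/2` for
  `LR([0,n+1]×[0,n])`, range-1 dependence persist for every `s`; yet at `s = 1` (laminated
  endpoint: a.s. every vertex opens exactly one of its east/north edges; clusters are coalescing
  north-east staircases) the hard-way crossing probability of `w + [0, 8n] × [0, n]` is
  `≤ 2 (n+1) (32/81)^n` (`laminated_hardWay_le`), so `¬ HasBoxCrossingProperty (extCornerPercolation 1)`
  and the crux with `t ≤ 1` dropped is FALSE. CONSEQUENCE FOR PROVERS: no argument using only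
  {self-duality, the diagonal symmetry, exact-1/2 identities, translation invariance, finite-range
  dependence / product structure of the corners} can prove the crux — each of these holds at `s = 1`.
  The proof must use positive association (FKG, `t ≤ 1`) QUANTITATIVELY (cf. ideator-1 notes §4:
  the shear family `A_λ` shows the same for shear-blind arguments; lamination is its `λ = ∞` end,
  now a theorem). Landed as `Negative/LaminatedPaths.lean` + `Negative/FalseWithoutFKG.lean`.
* §2b UNIFORMITY IS LOAD-BEARING (`not_uniform_boxCrossingBounds_below_lamination`): even with the
  laminated endpoint EXCLUDED, no constants `(c, n₀)` serve all `s ∈ [0, 1)` at aspect ratio 8 —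
  finite-volume crossing probabilities are continuous in `s` (`determinedBy_preimage_embRectCrossing`
  + the tree's `continuous_prodBernoulli_real_of_determinedBy`), so uniform bounds would pass to
  `s = 1`. Numerically each `M_s`, `s < 1`, is box-crossing with constants degenerating as `s → 1`
  (§3: t = 1.75, 1.9): "RSW pointwise but not uniformly" is REAL on this family, i.e. the planner's
  second failure mode exists next door; uniform constants on the FKG segment must come from a
  quantitative use of `t ≤ 1`, not from compactness + pointwise RSW alone (pointwise RSW gives no
  modulus of continuity). To be landed as `Negative/UniformityFails.lean` after part 2.
* §2c THE SOFT STRUCTURE PERSISTS ON THE WHOLE EXTENDED FAMILY (port of `CornerPercolation`'s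
  symmetry section to `extCornerPercolation s`): translation invariance, transpose invariance,
  self-duality `map dualConfig = map (point reflection)`, `M_s(LR(m+1,n)) + M_s(LR(n+1,m)) = 1` and
  `M_s(LR(n+1,n)) = 1/2` EXACTLY for every `s ∈ [0,1]`. CAPSTONE no-go theorem
  `exists_selfDual_symmetric_exactHalf_not_boxCrossing`: a translation- and diagonally-invariant,
  self-dual probability measure on bond configurations of `ℤ²` (a range-1 block factor of i.i.d.
  coins) with ALL `(n+1)×n` rectangles crossed with probability exactly `1/2` that does NOT have
  the box-crossing property. To be landed as `Negative/ExtendedFamilySymmetries.lean` (part 4).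
* §2d LINE `Sketch` KERNEL BEYOND FKG IS FALSE (`nonSlant_false_without_FKG`, `-- Targets`): the
  lead's kernel stub `stub_nonSlant` (B–R Non-Slant, `5|y₀-x₀| ≤ 3n`) with `cornerPercolation t`
  replaced by `extCornerPercolation s`, `s ∈ [0,1]`, fails: at `s = 1`, in `[0,5m]²`, a top–bottom
  open path is an orbit ascent to the top row followed by a flat run of heads, so either some
  bottom vertex's orbit makes `≥ 5m` north steps among its first `9m` (probability
  `≤ ((9/10)^9 (5/4)^4)^m ≈ .946^m` each, weighting `y = 4/5`) or some top vertex starts a run of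
  `m+1` heads (`2^-(m+1)` each): `P ≤ (5m+1)(.946^m + 2^-(m+1)) → 0` (`laminated_nonSlant_le`).
  So the kernel, like the crux, is reachable only through a quantitative use of `t ≤ 1`; the stub
  AS STATED (t ∈ [0,1]) is not refuted and is numerically robust (§3). Landing part 5
  `Negative/NonSlantFailsWithoutFKG.lean`.
* §3 NUMERICS (kit job j016788, attached to the item; MC, 4 cores, 144 s; `t ∈ {0,…,2}`, lattice
  boxes, `n = 16…512`, ±0.006…0.03): hard-way `P_t(LR[0,2n]×[0,n])` is SCALE-STABLE and bounded
  below uniformly on the FKG segment — `t=0: .179 .165 .160 .150 .163 .144`, `t=.5: .204 .171 .179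
  .186 .150 .176`, `t=1: .206 .191 .177 .184 .151 .160` (n = 16,32,64,128,256,512); aspect 3:
  `.04–.08`; the minimum over `t ∈ [0,1]` sits at the Smirnov endpoint `t = 0` (anisotropy `√3`).
  Beyond FKG it degrades only near the laminated end: `t=1.5: .18→.15`, `t=1.75: .147 .131 .130
  .121 .120`, `t=1.9: .088 .073 .065 .049 .061`, `t=2: .015 .0008 0 0 0 0` (§2's theorem).
  Sanity `P_t(LR[0,n+1]×[0,n]) = .50 ± .02` for ALL `t ∈ [0,2]` incl. `t = 2` (exact-1/2 persists
  while RSW dies — §2 numerically). Line `Sketch` KERNEL `stub_nonSlant` (B–R Non-Slant, threshold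
  `3n/5`): `P ≈ .47–.53` for all `t ∈ [0,1.5]`, all `n` — equal to `P(TB square) ≈ .5` within
  error: whenever the square is crossed it is crossed with slant `≤ n/5` (th. 0.2: `.39–.50`); mean
  signed minimal slant `-.07n (t=0) ↗ 0 (t=1) ↗ +.90n (t=2)` and extreme-point drift `-.24n ↗ 0 ↗
  +.93n`, MONOTONE in `t` at every `n` (chirality flips sign exactly at the isotropic point `t=1`;
  supports card chirality-response-sign's MonotoneChirality). So the kernel stub is numerically
  robust with `c ≈ .45`, and collapses only at `t = 2` (`.41 .25 .07 .003 0 0`).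
* §4 LINE `Sketch` stubs (lead: stub_glue, stub_upper LANDED): all six stubs are consequences of
  the crux (equivalent in strength to bounded anisotropy); degenerate cases checked on paper:
  `stub_brChain` needs `n₀ ≥ 1` (k ∈ [1,n]) — fine (∃ n₀); `stub_join` with `K`-fold gluing uses FKG
  (`cornerPercolation_real_inter_ge`, t ≤ 1 — consistent with §2: the engine is where FKG enters);
  `stub_render` must choose `n₀ ≥ 2` (§1). No stub is refutable separately from the crux; the one
  shear-sensitive datum is `stub_nonSlant`, numerically healthy (§3). Attack surface left for cycle 2:
  a t-uniform LOWER bound on anisotropy drift is not needed by the line, so none.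
-/

namespace Summit.CriticalPhenomena.CardyFormulaZ2.Cruxes.UniformBoxCrossing.Disproof

open MeasureTheory Filter Literature.Probability.Percolation Literature.Probability.LatticeModels
open Summit.CriticalPhenomena.CardyFormulaZ2.Theses.CardySelfDualSegment
open scoped Topology

noncomputable section

/-! ## §0 The crux, unfolded -/

/-- The crux is literally uniform `BoxCrossingBounds` for `cornerPercolation t`
(the route's inlined `prm`/`cfg` are `cornerParam`/`cornerConfig`). -/
theorem uniformBoxCrossing_iff :
    UniformBoxCrossing ↔ ∀ ρ : ℝ, 0 < ρ → ∃ c > 0, ∃ n₀ : ℕ, ∀ t : unitInterval,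
      BoxCrossingBounds (cornerPercolation t) squareLatticeEmbedding.z ρ c n₀ :=
  Iff.rfl

/-! ## §1 Tightness: the eventual-in-`n` clause cannot start below `n₀ = 2` -/

/-- `√2 > 7/5`. -/
theorem sqrt_two_gt : (7 / 5 : ℝ) < Real.sqrt 2 := by
  rw [show (7 / 5 : ℝ) = Real.sqrt ((7/5)^2) by rw [Real.sqrt_sq (by norm_num)]]
  exact Real.sqrt_lt_sqrt (by norm_num) (by norm_num)

/-- `√2 < 3/2`. -/
theorem sqrt_two_lt : Real.sqrt 2 < (3 / 2 : ℝ) := by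
  rw [show (3 / 2 : ℝ) = Real.sqrt ((3/2)^2) by rw [Real.sqrt_sq (by norm_num)]]
  exact Real.sqrt_lt_sqrt (by norm_num) (by norm_num)

/-- No vertex of `√2 ℤ² + (11/10) i` has imaginary part in `[0, 1]`. -/
theorem im_not_mem_Icc (v : Site 2) :
    (squareLatticeEmbedding.z v - (-(11 / 10 : ℝ) * Complex.I)).im ∉ Set.Icc (0 : ℝ) 1 := by
  have hz : (squareLatticeEmbedding.z v - (-(11 / 10 : ℝ) * Complex.I)).im =
      Real.sqrt 2 * (v 1 : ℝ) + 11 / 10 := by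
    simp [squareLatticeEmbedding, Site.toComplex]
  rw [hz]
  rintro ⟨h0, h1⟩
  have hs := sqrt_two_gt
  rcases le_or_gt 0 (v 1) with hv | hv
  · have : (0 : ℝ) ≤ (v 1 : ℝ) := by exact_mod_cast hv
    nlinarith
  · have hv' : v 1 ≤ -1 := by omega
    have : (v 1 : ℝ) ≤ -1 := by exact_mod_cast hv'
    nlinarith

/-- **Tightness of `n₀`.** For every measure `μ` on bond configurations of `ℤ²`, every aspect
ratio `ρ` and every `c > 0`, the box-crossing bounds on `√2 ℤ²` FAIL if the eventual clause starts
at `n₀ ≤ 1`: at scale `n = 1` the strip `w + ℝ × [0, 1]`, `w = -(11/10) i`, contains no vertex, so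
the horizontal crossing event of `w + [0, ρ] × [0, 1]` is empty and has probability `0 < c`. -/
theorem boxCrossingBounds_square_false_of_le_one (μ : Measure (BondConfig (Site 2))) {ρ c : ℝ}
    (hc : 0 < c) {n₀ : ℕ} (hn₀ : n₀ ≤ 1) :
    ¬ BoxCrossingBounds μ squareLatticeEmbedding.z ρ c n₀ := by
  intro h
  have h1 := (h 1 hn₀ (-(11 / 10 : ℝ) * Complex.I)).1.1
  have hempty : embRectCrossing (fun v => squareLatticeEmbedding.z v - (-(11 / 10 : ℝ) * Complex.I))
      (ρ * (1 : ℕ)) (1 : ℕ) = ∅ := by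
    ext ω
    simp only [embRectCrossing, mem_openCrossing_iff, Set.mem_setOf_eq, Set.mem_empty_iff_false,
      iff_false, not_exists, not_and]
    intro x _ y _ hω
    obtain ⟨hx, _, _⟩ := hω
    exact im_not_mem_Icc x (by simpa using hx.2)
  rw [hempty, measureReal_empty] at h1
  exact absurd h1 (not_le.2 hc)

/-- Corollary: every witness `(c, n₀)` of the crux at any aspect ratio has `n₀ ≥ 2`. -/
theorem two_le_of_boxCrossingBounds (μ : Measure (BondConfig (Site 2))) {ρ c : ℝ} (hc : 0 < c)
    {n₀ : ℕ} (h : BoxCrossingBounds μ squareLatticeEmbedding.z ρ c n₀) : 2 ≤ n₀ := by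
  by_contra hlt
  exact boxCrossingBounds_square_false_of_le_one μ hc (by omega) h

/-! ## §2 FKG is load-bearing: the extended corner family and its laminated endpoint

(Verbatim the content of `Theorems/UniformBoxCrossing/Negative/LaminatedPaths.lean` and
`Negative/FalseWithoutFKG.lean`, kept inline here until those proposals are merged; then this
section will import them.) -/

/-! ### The laminated configuration of a coin assignment -/

open Classical in
/-- One lamination step: from `v` go east if the coin of `v` is heads, north otherwise. -/
def lamStep (c : Set (Site 2)) (v : Site 2) : Site 2 :=
  if v ∈ c then v + ![1, 0] else v + ![0, 1]

/-- The forward orbit of `x` under `lamStep c`. -/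
def lamOrbit (c : Set (Site 2)) (x : Site 2) : ℕ → Site 2
  | 0 => x
  | j + 1 => lamStep c (lamOrbit c x j)

/-- The laminated bond configuration: every vertex opens exactly one of its east/north edges,
the east one iff its coin is heads. -/
def lamConfig (c : Set (Site 2)) : BondConfig (Site 2) :=
  {e | ∃ v : Site 2, (e = s(v, v + ![1, 0]) ∧ v ∈ c) ∨ (e = s(v, v + ![0, 1]) ∧ v ∉ c)}

/-- The orbit starts at `x`. -/
@[simp] theorem lamOrbit_zero (c : Set (Site 2)) (x : Site 2) : lamOrbit c x 0 = x := rfl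

/-- One more orbit step. -/
@[simp] theorem lamOrbit_succ (c : Set (Site 2)) (x : Site 2) (j : ℕ) :
    lamOrbit c x (j + 1) = lamStep c (lamOrbit c x j) := rfl

/-- The orbit after one step is the orbit of `lamStep c x`. -/
theorem lamOrbit_succ' (c : Set (Site 2)) (x : Site 2) (j : ℕ) :
    lamOrbit c x (j + 1) = lamOrbit c (lamStep c x) j := by
  induction j with
  | zero => rfl
  | succ j ih => rw [lamOrbit_succ, ih, lamOrbit_succ]

/-- Orbit times add. -/
theorem lamOrbit_add (c : Set (Site 2)) (x : Site 2) (i j : ℕ) :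
    lamOrbit c x (i + j) = lamOrbit c (lamOrbit c x i) j := by
  induction j with
  | zero => rfl
  | succ j ih => rw [← Nat.add_assoc, lamOrbit_succ, ih, lamOrbit_succ]

/-- When all splitting bits are present, the corner configuration is the laminated configuration
of the coins. -/
theorem cornerConfig_eq_lamConfig {S : Set (Site 2 × Fin 2)} (hS : ∀ v, (v, (1 : Fin 2)) ∈ S) :
    cornerConfig S = lamConfig {v | (v, (0 : Fin 2)) ∈ S} := by
  ext e
  simp only [mem_cornerConfig_iff, lamConfig, Set.mem_setOf_eq]
  constructor
  · rintro ⟨v, h | h⟩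
    · exact ⟨v, Or.inl h⟩
    · exact ⟨v, Or.inr ⟨h.1, fun hv => h.2.1 hv (hS v)⟩⟩
  · rintro ⟨v, h | h⟩
    · exact ⟨v, Or.inl h⟩
    · exact ⟨v, Or.inr ⟨h.1, ⟨fun hv => absurd hv h.2, fun _ => by
        exact absurd (hS v) ‹_›⟩⟩⟩

open Classical in
/-- The step vector coordinates. -/
theorem lamStep_apply_zero (c : Set (Site 2)) (v : Site 2) :
    lamStep c v 0 = v 0 + (if v ∈ c then 1 else 0) := by
  unfold lamStep; split_ifs <;> simp

open Classical in
/-- Ordinate of a lamination step. -/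
theorem lamStep_apply_one (c : Set (Site 2)) (v : Site 2) :
    lamStep c v 1 = v 1 + (if v ∈ c then 0 else 1) := by
  unfold lamStep; split_ifs <;> simp

/-- A lamination step raises `x + y` by one. -/
theorem lamStep_sum (c : Set (Site 2)) (v : Site 2) : lamStep c v 0 + lamStep c v 1 = v 0 + v 1 + 1 := by
  rw [lamStep_apply_zero, lamStep_apply_one]; split_ifs <;> ring

/-- Lamination steps do not decrease the abscissa. -/
theorem le_lamStep_zero (c : Set (Site 2)) (v : Site 2) : v 0 ≤ lamStep c v 0 := by
  rw [lamStep_apply_zero]; split_ifs <;> simp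

/-- Lamination steps do not decrease the ordinate. -/
theorem le_lamStep_one (c : Set (Site 2)) (v : Site 2) : v 1 ≤ lamStep c v 1 := by
  rw [lamStep_apply_one]; split_ifs <;> simp

/-- A lamination step moves. -/
theorem lamStep_ne_self (c : Set (Site 2)) (v : Site 2) : lamStep c v ≠ v := by
  intro h
  have := lamStep_sum c v
  rw [h] at this
  omega

/-- After `j` orbit steps `x + y` has risen by `j`. -/
theorem lamOrbit_sum (c : Set (Site 2)) (x : Site 2) (j : ℕ) :
    lamOrbit c x j 0 + lamOrbit c x j 1 = x 0 + x 1 + j := by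
  induction j with
  | zero => simp
  | succ j ih => rw [lamOrbit_succ, lamStep_sum, ih]; push_cast; ring

/-- Orbits do not decrease the abscissa. -/
theorem le_lamOrbit_zero (c : Set (Site 2)) (x : Site 2) (j : ℕ) : x 0 ≤ lamOrbit c x j 0 := by
  induction j with
  | zero => simp
  | succ j ih => exact ih.trans (le_lamStep_zero c _)

/-- Orbits do not decrease the ordinate. -/
theorem le_lamOrbit_one (c : Set (Site 2)) (x : Site 2) (j : ℕ) : x 1 ≤ lamOrbit c x j 1 := by
  induction j with
  | zero => simp
  | succ j ih => exact ih.trans (le_lamStep_one c _)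

/-- The ordinate is monotone along an orbit. -/
theorem lamOrbit_one_mono (c : Set (Site 2)) (x : Site 2) {i j : ℕ} (h : i ≤ j) :
    lamOrbit c x i 1 ≤ lamOrbit c x j 1 := by
  obtain ⟨k, rfl⟩ := Nat.exists_eq_add_of_le h
  rw [lamOrbit_add]
  exact le_lamOrbit_one c _ k

/-- An orbit never revisits a vertex. -/
theorem lamOrbit_injective (c : Set (Site 2)) (x : Site 2) : Function.Injective (lamOrbit c x) := by
  intro i j h
  have hi := lamOrbit_sum c x i
  have hj := lamOrbit_sum c x j
  rw [h] at hi
  omega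

/-- Adjacency in the laminated configuration: one endpoint is the lamination step of the other. -/
theorem adj_lamConfig_iff (c : Set (Site 2)) (u v : Site 2) :
    (openGraph (lamConfig c)).Adj u v ↔ v = lamStep c u ∨ u = lamStep c v := by
  rw [openGraph, SimpleGraph.fromEdgeSet_adj]
  simp only [lamConfig, Set.mem_setOf_eq]
  constructor
  · rintro ⟨⟨w, ⟨he, hw⟩ | ⟨he, hw⟩⟩, hne⟩
    · have hs : lamStep c w = w + ![1, 0] := by simp [lamStep, hw]
      rcases Sym2.eq_iff.1 he with ⟨rfl, rfl⟩ | ⟨rfl, rfl⟩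
      · exact Or.inl hs.symm
      · exact Or.inr hs.symm
    · have hs : lamStep c w = w + ![0, 1] := by simp [lamStep, hw]
      rcases Sym2.eq_iff.1 he with ⟨rfl, rfl⟩ | ⟨rfl, rfl⟩
      · exact Or.inl hs.symm
      · exact Or.inr hs.symm
  · rintro (h | h)
    · refine ⟨⟨u, ?_⟩, fun huv => lamStep_ne_self c u (h ▸ huv).symm⟩
      by_cases hu : u ∈ c
      · exact Or.inl ⟨by rw [h]; simp [lamStep, hu], hu⟩
      · exact Or.inr ⟨by rw [h]; simp [lamStep, hu], hu⟩
    · refine ⟨⟨v, ?_⟩, fun huv => lamStep_ne_self c v (h ▸ huv)⟩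
      by_cases hv : v ∈ c
      · exact Or.inl ⟨by rw [h, Sym2.eq_swap]; simp [lamStep, hv], hv⟩
      · exact Or.inr ⟨by rw [h, Sym2.eq_swap]; simp [lamStep, hv], hv⟩

/-- **Unimodality of simple paths in the laminated forest.** A simple path of the open graph of
`lamConfig c` (restricted to any vertex set `T`) first ASCENDS along the forward orbit of its start
and then DESCENDS along the (reversed) forward orbit of its end: there is `k ≤ length` with
`p_j = lamOrbit c u j` for `j ≤ k` and `p_j = lamOrbit c v (length - j)` for `k ≤ j ≤ length`.
(Every vertex has exactly one "upper" neighbour `lamStep c v`, so a valley would revisit a vertex.) -/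
theorem path_unimodal (c : Set (Site 2)) (T : Set (Site 2)) {u v : T}
    (p : ((openGraph (lamConfig c)).induce T).Walk u v) (hp : p.IsPath) :
    ∃ k, k ≤ p.length ∧ (∀ j, j ≤ k → (p.getVert j : Site 2) = lamOrbit c u j) ∧
      (∀ j, k ≤ j → j ≤ p.length → (p.getVert j : Site 2) = lamOrbit c v (p.length - j)) := by
  induction p with
  | nil =>
    exact ⟨0, le_rfl, fun j hj => by simp [Nat.le_zero.1 hj], fun j _ hj => by
      simp [SimpleGraph.Walk.length_nil] at hj; simp [hj]⟩
  | @cons a b w hab q ih =>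
    rw [SimpleGraph.Walk.cons_isPath_iff] at hp
    obtain ⟨k, hk, hasc, hdesc⟩ := ih hp.1
    have hab' : (openGraph (lamConfig c)).Adj (a : Site 2) b := hab
    rw [adj_lamConfig_iff] at hab'
    rcases hab' with hup | hdown
    · -- step up: prepend to the ascending part
      refine ⟨k + 1, by simp; omega, fun j hj => ?_, fun j hj hjl => ?_⟩
      · rcases j with _ | j
        · simp
        · rw [SimpleGraph.Walk.getVert_cons_succ, hasc j (by omega), lamOrbit_succ', ← hup]
      · rcases j with _ | j
        · omega
        · rw [SimpleGraph.Walk.getVert_cons_succ, SimpleGraph.Walk.length_cons,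
            hdesc j (by omega) (by simp at hjl; omega)]
          congr 1
          omega
    · -- step down: the rest must be entirely descending (else it would revisit `a`)
      have hk0 : k = 0 := by
        by_contra hk0
        have h1 := hasc 1 (by omega)
        simp only [lamOrbit_succ, lamOrbit_zero] at h1
        have hmem : q.getVert 1 ∈ q.support := q.getVert_mem_support 1
        have heq : q.getVert 1 = a := Subtype.ext (by rw [h1, ← hdown])
        exact hp.2 (heq ▸ hmem)
      subst hk0
      refine ⟨0, by simp, fun j hj => by simp [Nat.le_zero.1 hj], fun j _ hjl => ?_⟩
      rcases j with _ | j
      · have h0 := hdesc 0 le_rfl (Nat.zero_le _)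
        simp only [SimpleGraph.Walk.getVert_zero, Nat.sub_zero] at h0
        simp only [SimpleGraph.Walk.getVert_zero, SimpleGraph.Walk.length_cons, Nat.sub_zero,
          lamOrbit_succ, ← h0]
        exact hdown
      · rw [SimpleGraph.Walk.getVert_cons_succ, SimpleGraph.Walk.length_cons,
          hdesc j (by omega) (by simp at hjl; omega)]
        congr 1
        omega

/-! ### From a laminated crossing to an orbit event -/

/-- `√2 < 3/2`. -/
theorem sqrt_two_lt' : Real.sqrt 2 < (3 / 2 : ℝ) := by
  rw [show (3 / 2 : ℝ) = Real.sqrt ((3/2)^2) by rw [Real.sqrt_sq (by norm_num)]]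
  exact Real.sqrt_lt_sqrt (by norm_num) (by norm_num)

/-- In a laminated configuration, an open crossing between two sets inside `T` forces the forward
orbit of its left endpoint to stay in `T` up to a vertex `m` lying weakly north-east of the right
endpoint (the peak of the unimodal path). -/
theorem lam_openCrossing_orbit (c : Set (Site 2)) {T A B : Set (Site 2)}
    (h : lamConfig c ∈ openCrossing T A B) :
    ∃ x ∈ A, ∃ y ∈ B, x ∈ T ∧ ∃ k : ℕ, lamOrbit c x k ∈ T ∧ y 0 ≤ lamOrbit c x k 0 := by
  classical
  obtain ⟨x, hxA, y, hyB, hxT, hyT, hreach⟩ := h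
  obtain ⟨W⟩ := hreach
  set p := W.toPath with hp
  obtain ⟨k, hk, hasc, hdesc⟩ := path_unimodal c T p.1 p.2
  refine ⟨x, hxA, y, hyB, hxT, k, ?_, ?_⟩
  · rw [← hasc k le_rfl]; exact (p.1.getVert k).2
  · rw [← hasc k le_rfl, hdesc k le_rfl hk]; exact le_lamOrbit_zero c y _

/-- The finite box containing every possible left endpoint of a horizontal crossing of
`w + [0, a] × [0, n]` on `√2 ℤ²`. -/
def startBox (w : ℂ) (n : ℕ) : Finset (Site 2) :=
  Finset.Icc ![⌊w.re / Real.sqrt 2⌋ - 1, ⌈w.im / Real.sqrt 2⌉]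
    ![⌊w.re / Real.sqrt 2⌋, ⌈w.im / Real.sqrt 2⌉ + n]

/-- The start box has `2 (n + 1)` vertices. -/
theorem card_startBox (w : ℂ) (n : ℕ) : (startBox w n).card = 2 * (n + 1) := by
  rw [startBox, Pi.card_Icc, Fin.prod_univ_two]
  simp only [Matrix.cons_val_zero, Matrix.cons_val_one, Int.card_Icc]
  have h1 : (⌊w.re / Real.sqrt 2⌋ + 1 - (⌊w.re / Real.sqrt 2⌋ - 1)).toNat = 2 := by
    rw [show ⌊w.re / Real.sqrt 2⌋ + 1 - (⌊w.re / Real.sqrt 2⌋ - 1) = 2 by ring]; rfl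
  have h2 : (⌈w.im / Real.sqrt 2⌉ + ↑n + 1 - ⌈w.im / Real.sqrt 2⌉).toNat = n + 1 := by
    rw [show ⌈w.im / Real.sqrt 2⌉ + ↑n + 1 - ⌈w.im / Real.sqrt 2⌉ = (n + 1 : ℕ) by push_cast; ring]
    exact Int.toNat_natCast _
  rw [h1, h2]

/-- Every admissible left endpoint of a horizontal crossing of `w + [0, a] × [0, n]` lies in the
start box (floor/ceiling bookkeeping on `√2 ℤ² - w`). -/
theorem mem_startBox {w : ℂ} {n : ℕ} {x : Site 2}
    (hre : (squareLatticeEmbedding.z x - w).re ∈ Set.Icc (-2 : ℝ) 0)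
    (him : (squareLatticeEmbedding.z x - w).im ∈ Set.Icc (0 : ℝ) n) : x ∈ startBox w n := by
  have hr0 : (0 : ℝ) < Real.sqrt 2 := by positivity
  have hr1 := Real.one_lt_sqrt_two
  simp only [Complex.sub_re, Complex.sub_im, TrackExchange.zsq_re, TrackExchange.zsq_im,
    Set.mem_Icc] at hre him
  set a := ⌊w.re / Real.sqrt 2⌋ with ha
  set b := ⌈w.im / Real.sqrt 2⌉ with hb
  have ha1 : (a : ℝ) ≤ w.re / Real.sqrt 2 := Int.floor_le _
  have ha2 : w.re / Real.sqrt 2 < a + 1 := Int.lt_floor_add_one _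
  have hb1 : w.im / Real.sqrt 2 ≤ b := Int.le_ceil _
  have hb2 : (b : ℝ) - 1 < w.im / Real.sqrt 2 := by have := Int.ceil_lt_add_one (w.im / Real.sqrt 2); linarith
  rw [div_lt_iff₀ hr0] at ha2
  rw [le_div_iff₀ hr0] at ha1
  rw [div_le_iff₀ hr0] at hb1
  rw [lt_div_iff₀ hr0] at hb2
  have hx0 : x 0 ≤ a := by
    have h : (x 0 : ℝ) < a + 1 := by nlinarith [hre.2]
    have h' : x 0 < a + 1 := by exact_mod_cast h
    omega
  have hx0' : a - 1 ≤ x 0 := by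
    have : ((a : ℝ) - 2) < x 0 := by nlinarith [hre.1]
    have : a - 2 < x 0 := by exact_mod_cast this
    omega
  have hx1 : b ≤ x 1 := by
    have : ((b : ℝ) - 1) < x 1 := by nlinarith [him.1]
    have : b - 1 < x 1 := by exact_mod_cast this
    omega
  have hx1' : x 1 ≤ b + n := by
    have : (x 1 : ℝ) ≤ b + n := by nlinarith [him.2]
    exact_mod_cast this
  simp only [startBox, Finset.mem_Icc, Pi.le_def, Fin.forall_fin_two, Matrix.cons_val_zero,
    Matrix.cons_val_one]
  exact ⟨⟨hx0', hx1⟩, hx0, hx1'⟩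

/-- **Deterministic core of the lamination bound.** If the laminated configuration of `c` crosses
`w + [0, 8n] × [0, n]` horizontally (slack-2 event on `√2 ℤ²`), then some vertex `x` of the start
box has a forward orbit making at most `n` north steps among its first `5n` steps. -/
theorem lam_crossing_orbit (c : Set (Site 2)) (w : ℂ) (n : ℕ)
    (h : lamConfig c ∈ embRectCrossing (fun v => squareLatticeEmbedding.z v - w) (8 * n) n) :
    ∃ x ∈ startBox w n, lamOrbit c x (5 * n) 1 ≤ x 1 + n := by
  obtain ⟨x, hxA, y, hyB, hxT, k, hmT, hym⟩ := lam_openCrossing_orbit c h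
  simp only [Set.mem_setOf_eq] at hxA hyB hxT hmT
  refine ⟨x, mem_startBox ⟨hxT.1.1, hxA⟩ hxT.2, ?_⟩
  have hr1 := Real.one_lt_sqrt_two
  have hr2 := sqrt_two_lt'
  set m := lamOrbit c x k with hm
  simp only [Complex.sub_re, Complex.sub_im, TrackExchange.zsq_re, TrackExchange.zsq_im,
    Set.mem_Icc] at hxA hyB hxT hmT
  have hsum := lamOrbit_sum c x k
  have hm0 := le_lamOrbit_zero c x k
  have hm1 := le_lamOrbit_one c x k
  rw [← hm] at hsum hm0 hm1
  have hym' : (y 0 : ℝ) ≤ m 0 := by exact_mod_cast hym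
  -- east steps ≥ 5n
  have heast : 5 * (n : ℤ) ≤ m 0 - x 0 := by
    have h1 : (8 * n : ℝ) ≤ Real.sqrt 2 * (m 0 - x 0) := by nlinarith [hyB, hxA]
    have h2 : (0 : ℝ) ≤ m 0 - x 0 := by exact_mod_cast sub_nonneg.2 hm0
    have h3 : (5 * n : ℝ) ≤ m 0 - x 0 := by nlinarith
    exact_mod_cast h3
  -- north steps ≤ n
  have hnorth : m 1 - x 1 ≤ (n : ℤ) := by
    have h1 : Real.sqrt 2 * (m 1 - x 1) ≤ n := by nlinarith [hmT.2.2, hxT.2.1]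
    have h2 : (0 : ℝ) ≤ m 1 - x 1 := by exact_mod_cast sub_nonneg.2 hm1
    have h3 : (m 1 : ℝ) - x 1 ≤ n := by nlinarith
    exact_mod_cast h3
  have hk : 5 * n ≤ k := by
    have : (5 * n : ℤ) ≤ k := by linarith
    exact_mod_cast this
  calc lamOrbit c x (5 * n) 1 ≤ m 1 := lamOrbit_one_mono c x hk
    _ ≤ x 1 + n := by linarith

/-! ### Orbit patterns and their cylinders -/

/-- Positions of an abstract east/north step pattern `β` (`true` = north) started at `x`. -/
def patPos (β : ℕ → Bool) (x : Site 2) : ℕ → Site 2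
  | 0 => x
  | j + 1 => patPos β x j + (if β j then ![0, 1] else ![1, 0])

/-- A pattern walk starts at `x`. -/
@[simp] theorem patPos_zero (β : ℕ → Bool) (x : Site 2) : patPos β x 0 = x := rfl

/-- One more pattern step. -/
theorem patPos_succ (β : ℕ → Bool) (x : Site 2) (j : ℕ) :
    patPos β x (j + 1) = patPos β x j + (if β j then ![0, 1] else ![1, 0]) := rfl

/-- Abscissa after one more pattern step. -/
theorem patPos_succ_apply_zero (β : ℕ → Bool) (x : Site 2) (j : ℕ) :
    patPos β x (j + 1) 0 = patPos β x j 0 + (if β j then 0 else 1) := by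
  rw [patPos_succ, Pi.add_apply]
  by_cases h : β j
  · rw [if_pos h, if_pos h]; rfl
  · rw [if_neg h, if_neg h]; rfl

/-- Ordinate after one more pattern step. -/
theorem patPos_succ_apply_one (β : ℕ → Bool) (x : Site 2) (j : ℕ) :
    patPos β x (j + 1) 1 = patPos β x j 1 + (if β j then 1 else 0) := by
  rw [patPos_succ, Pi.add_apply]
  by_cases h : β j
  · rw [if_pos h, if_pos h]; rfl
  · rw [if_neg h, if_neg h]; rfl

/-- After `j` pattern steps `x + y` has risen by `j`. -/
theorem patPos_sum (β : ℕ → Bool) (x : Site 2) (j : ℕ) :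
    patPos β x j 0 + patPos β x j 1 = x 0 + x 1 + j := by
  induction j with
  | zero => simp
  | succ j ih =>
    rw [patPos_succ_apply_zero, patPos_succ_apply_one]
    by_cases h : β j
    · rw [if_pos h, if_pos h]; push_cast; linarith
    · rw [if_neg h, if_neg h]; push_cast; linarith

/-- The ordinate after `j` pattern steps counts the north steps so far. -/
theorem patPos_apply_one (β : ℕ → Bool) (x : Site 2) (j : ℕ) :
    patPos β x j 1 = x 1 + ((Finset.range j).filter fun i => β i = true).card := by
  induction j with
  | zero => simp
  | succ j ih =>
    rw [patPos_succ_apply_one, Finset.range_add_one, Finset.filter_insert, ih]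
    by_cases h : β j
    · rw [if_pos h, if_pos h, Finset.card_insert_of_notMem (by simp)]; push_cast; ring
    · rw [if_neg h, if_neg h]; ring

/-- A pattern walk never revisits a vertex. -/
theorem patPos_injective (β : ℕ → Bool) (x : Site 2) : Function.Injective (patPos β x) := by
  intro i j h
  have hi := patPos_sum β x i
  have hj := patPos_sum β x j
  rw [h] at hi
  omega

/-- The step pattern of a finite set `s ⊆ {0, …, K-1}` of north positions. -/
def extB {K : ℕ} (s : Finset (Fin K)) (i : ℕ) : Bool := if h : i < K then decide (⟨i, h⟩ ∈ s) else false

/-- `extB s` is the indicator of `s` below `K`. -/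
theorem extB_eq_true_iff {K : ℕ} (s : Finset (Fin K)) {i : ℕ} (hi : i < K) :
    extB s i = true ↔ (⟨i, hi⟩ : Fin K) ∈ s := by
  simp [extB, hi]

/-- The number of north steps of the pattern of `s` is `|s|`. -/
theorem card_filter_extB {K : ℕ} (s : Finset (Fin K)) :
    ((Finset.range K).filter fun i => extB s i = true).card = s.card := by
  have h : ((Finset.range K).filter fun i => extB s i = true) = s.map Fin.valEmbedding := by
    ext i
    simp only [Finset.mem_filter, Finset.mem_range, Finset.mem_map, Fin.valEmbedding_apply]
    constructor
    · rintro ⟨hi, he⟩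
      exact ⟨⟨i, hi⟩, (extB_eq_true_iff s hi).1 he, rfl⟩
    · rintro ⟨j, hj, rfl⟩
      exact ⟨j.2, (extB_eq_true_iff s j.2).2 hj⟩
  rw [h, Finset.card_map]

/-- The coin cylinder of the pattern `s` started at `x`: the coin at the `j`-th position is heads
(east) iff `j ∉ s`. -/
def patCyl {K : ℕ} (x : Site 2) (s : Finset (Fin K)) : Set (Set (Site 2 × Fin 2)) :=
  {S | ∀ j : Fin K, ((patPos (extB s) x j, (0 : Fin 2)) ∈ S ↔ j ∉ s)}

/-- The set of coins (heads) of `S`. -/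
def coins (S : Set (Site 2 × Fin 2)) : Set (Site 2) := {v | (v, (0 : Fin 2)) ∈ S}

/-- Membership in `coins S`, unfolded. -/
@[simp] theorem mem_coins {S : Set (Site 2 × Fin 2)} {v : Site 2} : v ∈ coins S ↔ (v, (0 : Fin 2)) ∈ S :=
  Iff.rfl

open Classical in
/-- The north pattern of the first `K` orbit steps of the coins of `S`. -/
def patOf (S : Set (Site 2 × Fin 2)) (x : Site 2) (K : ℕ) : Finset (Fin K) :=
  Finset.univ.filter fun j => lamOrbit (coins S) x j ∉ coins S

/-- Membership in the north pattern, unfolded. -/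
theorem mem_patOf_iff (S : Set (Site 2 × Fin 2)) (x : Site 2) (K : ℕ) (j : Fin K) :
    j ∈ patOf S x K ↔ lamOrbit (coins S) x j ∉ coins S := by
  simp [patOf]

/-- The pattern of `S` records the north steps of the orbit. -/
theorem extB_patOf_eq_true_iff (S : Set (Site 2 × Fin 2)) (x : Site 2) (K : ℕ) {i : ℕ} (hi : i < K) :
    extB (patOf S x K) i = true ↔ lamOrbit (coins S) x i ∉ coins S := by
  rw [extB_eq_true_iff _ hi, mem_patOf_iff]

/-- The orbit of the coins of `S` is the pattern walk of its own north pattern. -/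
theorem lamOrbit_eq_patPos (S : Set (Site 2 × Fin 2)) (x : Site 2) (K : ℕ) :
    ∀ j, j ≤ K → lamOrbit (coins S) x j = patPos (extB (patOf S x K)) x j := by
  intro j
  induction j with
  | zero => intro; rfl
  | succ j ih =>
    intro hj
    have hjK : j < K := by omega
    rw [lamOrbit_succ, patPos_succ, ← ih hjK.le]
    unfold lamStep
    by_cases h : lamOrbit (coins S) x j ∈ coins S
    · have hb : ¬ (extB (patOf S x K) j = true) := fun hb =>
        ((extB_patOf_eq_true_iff S x K hjK).1 hb) h
      rw [if_pos h, if_neg hb]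
    · have hb : extB (patOf S x K) j = true := (extB_patOf_eq_true_iff S x K hjK).2 h
      rw [if_neg h, if_pos hb]

/-- `S` lies in the cylinder of its own pattern. -/
theorem mem_patCyl_patOf (S : Set (Site 2 × Fin 2)) (x : Site 2) (K : ℕ) : S ∈ patCyl x (patOf S x K) := by
  intro j
  rw [← lamOrbit_eq_patPos S x K j (le_of_lt j.2), mem_patOf_iff, not_not]
  rfl

/-- The ordinate after `K` orbit steps counts the north steps. -/
theorem lamOrbit_apply_one_eq (S : Set (Site 2 × Fin 2)) (x : Site 2) (K : ℕ) :
    lamOrbit (coins S) x K 1 = x 1 + (patOf S x K).card := by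
  rw [lamOrbit_eq_patPos S x K K le_rfl, patPos_apply_one, card_filter_extB]

/-- The orbit event is covered by the cylinders of the patterns with few north steps. -/
theorem orbitEvent_subset (x : Site 2) (K : ℕ) (n : ℕ) :
    {S : Set (Site 2 × Fin 2) | lamOrbit (coins S) x K 1 ≤ x 1 + n} ⊆
      ⋃ s ∈ (Finset.univ : Finset (Finset (Fin K))).filter (fun s => s.card ≤ n), patCyl x s := by
  intro S hS
  simp only [Set.mem_setOf_eq, lamOrbit_apply_one_eq] at hS
  simp only [Set.mem_iUnion, Finset.mem_filter, Finset.mem_univ, true_and, exists_prop]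
  exact ⟨patOf S x K, by exact_mod_cast (by linarith : ((patOf S x K).card : ℤ) ≤ n),
    mem_patCyl_patOf S x K⟩

/-! ### Cylinder probabilities -/

open ProbabilityTheory in
/-- Cylinder probability along an injective family of coordinates. -/
theorem prodBernoulli_real_cylinder_of_injective {ι κ : Type*} [Fintype κ] (p : ι → unitInterval)
    {φ : κ → ι} (hφ : Function.Injective φ) (b : κ → Prop) :
    (prodBernoulli p).real {ω | ∀ j, φ j ∈ ω ↔ b j} =
      ∏ j, (Ber(True, False, p (φ j))).real {r | r ↔ b j} := by
  classical
  have hex : ∀ j, (∃ j', φ j' = φ j ∧ b j') ↔ b j := fun j =>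
    ⟨fun ⟨j', hj', hb'⟩ => hφ hj' ▸ hb', fun hb => ⟨j, rfl, hb⟩⟩
  have hpre : (fun q : ι → Prop => {i | q i}) ⁻¹' {ω : Set ι | ∀ j, φ j ∈ ω ↔ b j} =
      Set.pi (↑(Finset.univ.map ⟨φ, hφ⟩)) (fun i => {r | r ↔ ∃ j, φ j = i ∧ b j}) := by
    ext q
    simp only [Set.mem_preimage, Set.mem_setOf_eq, Set.mem_pi, Finset.coe_map,
      Function.Embedding.coeFn_mk, Finset.coe_univ, Set.image_univ, Set.mem_range]
    constructor
    · rintro h i ⟨j, rfl⟩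
      rw [hex]
      exact h j
    · intro h j
      have := h (φ j) ⟨j, rfl⟩
      rw [hex] at this
      exact this
  rw [prodBernoulli_real_eq_infinitePi, measureReal_def, hpre,
    Measure.infinitePi_pi _ (fun _ _ => MeasurableSet.of_discrete), ENNReal.toReal_prod,
    Finset.prod_map]
  refine Finset.prod_congr rfl fun j _ => ?_
  rw [measureReal_def]
  congr 2
  ext r
  simp only [Set.mem_setOf_eq, Function.Embedding.coeFn_mk, hex]

open ProbabilityTheory in
/-- A fair coin lands on either prescribed side with probability `1/2`. -/
theorem ber_half_real_iff (b : Prop) : (Ber(True, False, half)).real {r | r ↔ b} = 1 / 2 := by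
  by_cases hb : b
  · have : {r | r ↔ b} = {True} := by ext r; simp [hb]
    rw [this, measureReal_def, bernoulliMeasure_prop_apply_true, ENNReal.toReal_ofReal (by simp),
      coe_half]
  · have : {r | r ↔ b} = {False} := by ext r; simp [hb]
    rw [this, measureReal_def, bernoulliMeasure_prop_apply_false,
      ENNReal.toReal_ofReal (by rw [coe_half]; norm_num), coe_half]
    norm_num

/-- Every orbit cylinder of length `K` has probability `(1/2)^K` when the coins are fair. -/
theorem real_patCyl (p : Site 2 × Fin 2 → unitInterval) (hp : ∀ v, p (v, 0) = half)
    {K : ℕ} (x : Site 2) (s : Finset (Fin K)) :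
    (prodBernoulli p).real (patCyl x s) = (1 / 2 : ℝ) ^ K := by
  have hφ : Function.Injective fun j : Fin K => (patPos (extB s) x j, (0 : Fin 2)) := by
    intro i j h
    simp only [Prod.mk.injEq, and_true] at h
    exact Fin.ext (patPos_injective _ _ h)
  have h := prodBernoulli_real_cylinder_of_injective p hφ (fun j => j ∉ s)
  rw [patCyl, h]
  simp only [hp, ber_half_real_iff, Finset.prod_const, Finset.card_univ, Fintype.card_fin]

/-- Counting patterns with few north steps by weighting: `#{s ⊆ Fin K : |s| ≤ n} ≤ 3^n (4/3)^K`. -/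
theorem card_filter_card_le (K n : ℕ) :
    (((Finset.univ : Finset (Finset (Fin K))).filter (fun s => s.card ≤ n)).card : ℝ) ≤
      3 ^ n * (4 / 3 : ℝ) ^ K := by
  set A := (Finset.univ : Finset (Finset (Fin K))).filter (fun s => s.card ≤ n) with hA
  have h1 : (A.card : ℝ) = ∑ s ∈ A, (1 : ℝ) := by simp
  have h2 : ∑ s ∈ A, (1 : ℝ) ≤ ∑ s ∈ A, 3 ^ n * (1 / 3 : ℝ) ^ s.card := by
    refine Finset.sum_le_sum fun s hs => ?_
    have hsn : s.card ≤ n := (Finset.mem_filter.1 hs).2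
    calc (1 : ℝ) = 3 ^ s.card * (1 / 3 : ℝ) ^ s.card := by rw [← mul_pow]; norm_num
      _ ≤ 3 ^ n * (1 / 3 : ℝ) ^ s.card := by gcongr; norm_num
  have h3 : ∑ s ∈ A, 3 ^ n * (1 / 3 : ℝ) ^ s.card ≤
      ∑ s : Finset (Fin K), 3 ^ n * (1 / 3 : ℝ) ^ s.card :=
    Finset.sum_le_sum_of_subset_of_nonneg (Finset.filter_subset _ _) fun _ _ _ => by positivity
  have h4 : ∑ s : Finset (Fin K), 3 ^ n * (1 / 3 : ℝ) ^ s.card = 3 ^ n * (4 / 3 : ℝ) ^ K := by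
    rw [← Finset.mul_sum]
    congr 1
    have := Fin.sum_pow_mul_eq_add_pow (n := K) (1 / 3 : ℝ) 1
    simp only [one_pow, mul_one] at this
    rw [this]; norm_num
  linarith

/-- **The orbit bound**: with fair coins, the forward lamination orbit of `x` makes at most `n`
north steps among its first `5n` steps with probability at most
`3^n (4/3)^(5n) (1/2)^(5n) = (32/81)^n`. -/
theorem real_orbitEvent_le (p : Site 2 × Fin 2 → unitInterval) (hp : ∀ v, p (v, 0) = half)
    (x : Site 2) (n : ℕ) :
    (prodBernoulli p).real {S | lamOrbit (coins S) x (5 * n) 1 ≤ x 1 + n} ≤ (32 / 81 : ℝ) ^ n := by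
  classical
  set A := (Finset.univ : Finset (Finset (Fin (5 * n)))).filter (fun s => s.card ≤ n) with hA
  calc (prodBernoulli p).real {S | lamOrbit (coins S) x (5 * n) 1 ≤ x 1 + n}
      ≤ (prodBernoulli p).real (⋃ s ∈ A, patCyl x s) :=
        measureReal_mono (orbitEvent_subset x (5 * n) n) (measure_ne_top _ _)
    _ ≤ ∑ s ∈ A, (prodBernoulli p).real (patCyl x s) := measureReal_biUnion_finset_le _ _
    _ = A.card * (1 / 2 : ℝ) ^ (5 * n) := by simp [real_patCyl p hp, Finset.sum_const]
    _ ≤ (3 ^ n * (4 / 3 : ℝ) ^ (5 * n)) * (1 / 2 : ℝ) ^ (5 * n) := by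
        gcongr; exact card_filter_card_le (5 * n) n
    _ = (32 / 81 : ℝ) ^ n := by
        rw [pow_mul, pow_mul, ← mul_pow, ← mul_pow]; norm_num

/-! ### The extended corner family `s ∈ [0,1]` and its laminated endpoint `s = 1` -/

/-- Extended corner parameters: the coin `(v, 0)` is fair, the splitting bit `(v, 1)` has
parameter `s ∈ [0, 1]` (disagreement probability `s`). The route's family is `s = t/2 ≤ 1/2`,
which is exactly the range where the corner law `(1/2 - s/2 | s/2, s/2 | 1/2 - s/2)` satisfies the
FKG lattice condition; `s ∈ (1/2, 1]` is the non-FKG continuation of the same self-dual family. -/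
def extCornerParam (s : unitInterval) : Site 2 × Fin 2 → unitInterval :=
  fun i => if i.2 = 0 then half else s

/-- The coin coordinate is fair. -/
@[simp] theorem extCornerParam_apply_zero (s : unitInterval) (v : Site 2) :
    extCornerParam s (v, 0) = half := by
  simp [extCornerParam]

/-- The splitting coordinate has parameter `s`. -/
@[simp] theorem extCornerParam_apply_one (s : unitInterval) (v : Site 2) :
    extCornerParam s (v, 1) = s := by
  simp [extCornerParam]

/-- The route's parameters are the extended ones at `s = t/2`. -/
theorem extCornerParam_half_mul (t : unitInterval) : extCornerParam (half * t) = cornerParam t := by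
  funext ⟨v, j⟩
  fin_cases j
  · simp [extCornerParam]
  · simp [extCornerParam]

/-- The extended corner model `M_s`: push-forward of `prodBernoulli (extCornerParam s)` under the
corner map. -/
def extCornerPercolation (s : unitInterval) : Measure (BondConfig (Site 2)) :=
  (prodBernoulli (extCornerParam s)).map cornerConfig

/-- The route's `cornerPercolation t` is `extCornerPercolation (t/2)`. -/
theorem extCornerPercolation_half_mul (t : unitInterval) :
    extCornerPercolation (half * t) = cornerPercolation t := by
  rw [extCornerPercolation, extCornerParam_half_mul, cornerPercolation_def]

/-- `M_s` is a probability measure. -/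
instance instIsProbabilityMeasureExtCornerPercolation (s : unitInterval) :
    IsProbabilityMeasure (extCornerPercolation s) :=
  Measure.isProbabilityMeasure_map measurable_cornerConfig.aemeasurable

/-- At the laminated endpoint `s = 1` every splitting bit is almost surely present. -/
theorem ae_forall_splitting_mem :
    ∀ᵐ S ∂(prodBernoulli (extCornerParam 1)), ∀ v : Site 2, (v, (1 : Fin 2)) ∈ S := by
  rw [ae_all_iff]
  intro v
  have h : (prodBernoulli (extCornerParam 1)).real {S | (v, (1 : Fin 2)) ∉ S} = 0 := by
    rw [prodBernoulli_real_setOf_notMem, extCornerParam_apply_one]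
    simp
  rw [ae_iff]
  exact (measureReal_eq_zero_iff (measure_ne_top _ _)).1 h

/-- **Lamination bound.** At `s = 1` (every vertex opens exactly one of its east/north edges, a.s.)
the horizontal crossing probability of `w + [0, 8n] × [0, n]` on `√2 ℤ²` is at most
`2 (n + 1) (32/81)^n`, uniformly in the translation `w`. -/
theorem laminated_hardWay_le (w : ℂ) (n : ℕ) :
    (extCornerPercolation 1).real
        (embRectCrossing (fun v => squareLatticeEmbedding.z v - w) (8 * n) n) ≤
      2 * (n + 1) * (32 / 81 : ℝ) ^ n := by
  set E := embRectCrossing (fun v => squareLatticeEmbedding.z v - w) (8 * n) n with hE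
  have hEm : MeasurableSet E := measurableSet_openCrossing_of_countable _ _ _
  rw [extCornerPercolation, map_measureReal_apply measurable_cornerConfig hEm]
  set μ := prodBernoulli (extCornerParam 1) with hμ
  set G : Set (Set (Site 2 × Fin 2)) := {S | ∀ v, (v, (1 : Fin 2)) ∈ S} with hG
  have hsub : cornerConfig ⁻¹' E ⊆
      (⋃ x ∈ startBox w n, {S | lamOrbit (coins S) x (5 * n) 1 ≤ x 1 + n}) ∪ Gᶜ := by
    intro S hS
    by_cases hSG : S ∈ G
    · left
      have hlam : lamConfig (coins S) ∈ E := by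
        have := cornerConfig_eq_lamConfig hSG
        rw [Set.mem_preimage, this] at hS
        exact hS
      obtain ⟨x, hx, hbad⟩ := lam_crossing_orbit (coins S) w n hlam
      simp only [Set.mem_iUnion, exists_prop]
      exact ⟨x, hx, hbad⟩
    · exact Or.inr hSG
  have hG0 : μ.real Gᶜ = 0 := by
    have h := ae_forall_splitting_mem
    rw [ae_iff] at h
    rw [measureReal_eq_zero_iff (measure_ne_top _ _)]
    exact h
  calc μ.real (cornerConfig ⁻¹' E)
      ≤ μ.real ((⋃ x ∈ startBox w n, {S | lamOrbit (coins S) x (5 * n) 1 ≤ x 1 + n}) ∪ Gᶜ) :=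
        measureReal_mono hsub (measure_ne_top _ _)
    _ ≤ μ.real (⋃ x ∈ startBox w n, {S | lamOrbit (coins S) x (5 * n) 1 ≤ x 1 + n}) +
          μ.real Gᶜ := measureReal_union_le _ _
    _ ≤ ∑ x ∈ startBox w n, μ.real {S | lamOrbit (coins S) x (5 * n) 1 ≤ x 1 + n} + 0 := by
        rw [hG0]
        gcongr
        exact measureReal_biUnion_finset_le _ _
    _ ≤ ∑ x ∈ startBox w n, (32 / 81 : ℝ) ^ n + 0 := by
        gcongr with x hx
        exact real_orbitEvent_le _ (fun v => extCornerParam_apply_zero 1 v) x n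
    _ = 2 * (n + 1) * (32 / 81 : ℝ) ^ n := by
        rw [Finset.sum_const, card_startBox, add_zero, nsmul_eq_mul]
        push_cast
        ring

/-- The lamination bound tends to `0`. -/
theorem tendsto_laminated_bound :
    Tendsto (fun n : ℕ => 2 * (n + 1) * (32 / 81 : ℝ) ^ n) atTop (𝓝 0) := by
  have h1 := tendsto_self_mul_const_pow_of_lt_one (r := (32 / 81 : ℝ)) (by norm_num) (by norm_num)
  have h2 := tendsto_pow_atTop_nhds_zero_of_lt_one (r := (32 / 81 : ℝ)) (by norm_num) (by norm_num)
  have h3 := (h1.add h2).const_mul 2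
  simp only [mul_zero, add_zero] at h3
  refine h3.congr fun n => ?_
  ring

/-- **No box-crossing bounds at the laminated endpoint**, for any constants, at aspect ratio `8`. -/
theorem not_boxCrossingBounds_laminated {c : ℝ} (hc : 0 < c) (n₀ : ℕ) :
    ¬ BoxCrossingBounds (extCornerPercolation 1) squareLatticeEmbedding.z 8 c n₀ := by
  intro h
  obtain ⟨N, hN⟩ := (tendsto_laminated_bound.eventually (gt_mem_nhds hc)).exists_forall_of_atTop
  have h1 := (h (max N n₀) (le_max_right _ _) 0).1.1
  have h2 := laminated_hardWay_le 0 (max N n₀)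
  have h3 := hN (max N n₀) (le_max_left _ _)
  linarith

/-- **`M_1^{ext}` (the laminated corner model) does not have the box-crossing property on `√2 ℤ²`.** -/
theorem not_hasBoxCrossingProperty_laminated :
    ¬ HasBoxCrossingProperty (extCornerPercolation 1) squareLatticeEmbedding.z := by
  intro h
  obtain ⟨c, hc, n₀, hb⟩ := h 8 (by norm_num)
  exact not_boxCrossingBounds_laminated hc n₀ hb

/-- `UniformBoxCrossing` with the FKG restriction `t ≤ 1` (i.e. `s ≤ 1/2`) DROPPED: uniform box
crossing along the whole extended self-dual segment `s ∈ [0, 1]`. -/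
def UniformBoxCrossingWithoutFKG : Prop :=
  ∀ ρ : ℝ, 0 < ρ → ∃ c > 0, ∃ n₀ : ℕ, ∀ s : unitInterval,
    BoxCrossingBounds (extCornerPercolation s) squareLatticeEmbedding.z ρ c n₀

/-- **FKG is load-bearing**: the extended statement is false (witness `s = 1`, `ρ = 8`). Any proof
of `UniformBoxCrossing` must use an input that fails beyond `t = 1` — the FKG lattice condition of
the corner law (equivalently positive association of `M_t`), since translation invariance,
diagonal symmetry, self-duality, exact-`1/2` squares and range-`1` dependence all persist up to
`s = 1`. -/
theorem uniformBoxCrossing_false_without_FKG : ¬ UniformBoxCrossingWithoutFKG := by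
  intro h
  obtain ⟨c, hc, n₀, hb⟩ := h 8 (by norm_num)
  exact not_boxCrossingBounds_laminated hc n₀ (hb 1)

/-! ### Uniformity is load-bearing: no constants serve the half-open segment `s ∈ [0, 1)` -/

/-- A finite box of `ℤ²` containing every vertex of the strip-rectangle of the slack-2 crossing
event of `w + [0, a] × [0, b]` on `√2 ℤ²`. -/
def stripBox (w : ℂ) (a b : ℝ) : Finset (Site 2) :=
  Finset.Icc ![⌊(w.re - 2) / Real.sqrt 2⌋, ⌊w.im / Real.sqrt 2⌋]
    ![⌈(w.re + a + 2) / Real.sqrt 2⌉, ⌈(w.im + b) / Real.sqrt 2⌉]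

/-- The strip-rectangle lies in the strip box. -/
theorem mem_stripBox {w : ℂ} {a b : ℝ} {v : Site 2}
    (hre : (squareLatticeEmbedding.z v - w).re ∈ Set.Icc (-2 : ℝ) (a + 2))
    (him : (squareLatticeEmbedding.z v - w).im ∈ Set.Icc (0 : ℝ) b) : v ∈ stripBox w a b := by
  have hr0 : (0 : ℝ) < Real.sqrt 2 := by positivity
  simp only [Complex.sub_re, Complex.sub_im, TrackExchange.zsq_re, TrackExchange.zsq_im,
    Set.mem_Icc] at hre him
  have h1 : ⌊(w.re - 2) / Real.sqrt 2⌋ ≤ v 0 := by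
    have : (w.re - 2) / Real.sqrt 2 ≤ v 0 := by rw [div_le_iff₀ hr0]; linarith [hre.1]
    exact_mod_cast (Int.floor_le _).trans this |> fun h => Int.cast_le.1 (h.trans_eq rfl)
  have h2 : (v 0 : ℤ) ≤ ⌈(w.re + a + 2) / Real.sqrt 2⌉ := by
    have : (v 0 : ℝ) ≤ (w.re + a + 2) / Real.sqrt 2 := by rw [le_div_iff₀ hr0]; linarith [hre.2]
    exact Int.cast_le.1 (this.trans (Int.le_ceil _))
  have h3 : ⌊w.im / Real.sqrt 2⌋ ≤ v 1 := by
    have : w.im / Real.sqrt 2 ≤ v 1 := by rw [div_le_iff₀ hr0]; linarith [him.1]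
    exact Int.cast_le.1 ((Int.floor_le _).trans this)
  have h4 : (v 1 : ℤ) ≤ ⌈(w.im + b) / Real.sqrt 2⌉ := by
    have : (v 1 : ℝ) ≤ (w.im + b) / Real.sqrt 2 := by rw [le_div_iff₀ hr0]; linarith [him.2]
    exact Int.cast_le.1 (this.trans (Int.le_ceil _))
  simp only [stripBox, Finset.mem_Icc, Pi.le_def, Fin.forall_fin_two, Matrix.cons_val_zero,
    Matrix.cons_val_one]
  exact ⟨⟨h1, h3⟩, h2, h4⟩

/-- **Locality of the corner map**: coin sets agreeing at the vertices of `T` induce the same open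
subgraph on `T`. -/
theorem induce_openGraph_cornerConfig_eq {T : Set (Site 2)} {S S' : Set (Site 2 × Fin 2)}
    (h : ∀ v ∈ T, ∀ j : Fin 2, (v, j) ∈ S ↔ (v, j) ∈ S') :
    (openGraph (cornerConfig S)).induce T = (openGraph (cornerConfig S')).induce T := by
  have key : ∀ (S S' : Set (Site 2 × Fin 2)), (∀ v ∈ T, ∀ j : Fin 2, (v, j) ∈ S ↔ (v, j) ∈ S') →
      ∀ a b : Site 2, a ∈ T → b ∈ T → s(a, b) ∈ cornerConfig S → s(a, b) ∈ cornerConfig S' := by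
    intro S S' h a b ha hb hab
    rw [mem_cornerConfig_iff] at hab ⊢
    obtain ⟨v, hv⟩ := hab
    have hvT : v ∈ T := by
      rcases hv with ⟨he, -⟩ | ⟨he, -⟩ <;>
      · rcases Sym2.eq_iff.1 he with ⟨rfl, -⟩ | ⟨-, rfl⟩
        · exact ha
        · exact hb
    refine ⟨v, ?_⟩
    rcases hv with ⟨he, hc⟩ | ⟨he, hc⟩
    · exact Or.inl ⟨he, (h v hvT 0).1 hc⟩
    · refine Or.inr ⟨he, ?_⟩
      rw [← h v hvT 0, ← h v hvT 1]
      exact hc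
  ext a b
  simp only [SimpleGraph.induce_adj, openGraph, SimpleGraph.fromEdgeSet_adj]
  exact and_congr_left fun _ =>
    ⟨key S S' h a b a.2 b.2, key S' S (fun v hv j => (h v hv j).symm) a b a.2 b.2⟩

/-- Open crossings inside `T` only see the open subgraph induced on `T`. -/
theorem openCrossing_congr_of_induce_eq {V : Type*} {T A B : Set V} {ω ω' : BondConfig V}
    (hG : (openGraph ω).induce T = (openGraph ω').induce T) :
    ω ∈ openCrossing T A B ↔ ω' ∈ openCrossing T A B := by
  simp only [mem_openCrossing_iff, openConnIn, Set.mem_setOf_eq, hG]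

/-- The preimage under the corner map of a slack-2 horizontal crossing event on `√2 ℤ²` is
determined by the coins and splitting bits of the (finitely many) vertices of the strip box. -/
theorem determinedBy_preimage_embRectCrossing (w : ℂ) (a b : ℝ) :
    DeterminedBy (cornerConfig ⁻¹' embRectCrossing (fun v => squareLatticeEmbedding.z v - w) a b)
      (↑(stripBox w a b ×ˢ (Finset.univ : Finset (Fin 2))) : Set (Site 2 × Fin 2)) := by
  rw [determinedBy_iff]
  intro S S' hSS'
  set T : Set (Site 2) := {v | (squareLatticeEmbedding.z v - w).re ∈ Set.Icc (-2 : ℝ) (a + 2) ∧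
    (squareLatticeEmbedding.z v - w).im ∈ Set.Icc (0 : ℝ) b} with hT
  have hagree : ∀ v ∈ T, ∀ j : Fin 2, (v, j) ∈ S ↔ (v, j) ∈ S' := by
    intro v hv j
    have hF : (v, j) ∈ (↑(stripBox w a b ×ˢ (Finset.univ : Finset (Fin 2))) : Set (Site 2 × Fin 2)) := by
      simp only [Finset.coe_product, Finset.coe_univ, Set.mem_prod, Finset.mem_coe, Set.mem_univ,
        and_true]
      exact mem_stripBox hv.1 hv.2
    constructor
    · intro hS
      exact ((Set.ext_iff.1 hSS' (v, j)).1 ⟨hS, hF⟩).1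
    · intro hS'
      exact ((Set.ext_iff.1 hSS' (v, j)).2 ⟨hS', hF⟩).1
  exact openCrossing_congr_of_induce_eq (induce_openGraph_cornerConfig_eq hagree)

/-- **Continuity in the splitting parameter** of every slack-2 crossing probability (finite volume:
a polynomial in `s`). -/
theorem continuous_extCornerPercolation_real_embRectCrossing (w : ℂ) (a b : ℝ) :
    Continuous fun s : unitInterval => (extCornerPercolation s).real
      (embRectCrossing (fun v => squareLatticeEmbedding.z v - w) a b) := by
  have hEm : MeasurableSet (embRectCrossing (fun v => squareLatticeEmbedding.z v - w) a b) :=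
    measurableSet_openCrossing_of_countable _ _ _
  have h := continuous_prodBernoulli_real_of_determinedBy (fun s : unitInterval => extCornerParam s)
    (determinedBy_preimage_embRectCrossing w a b) (fun i _ => ?_)
  · refine h.congr fun s => ?_
    rw [extCornerPercolation, map_measureReal_apply measurable_cornerConfig hEm]
  · rcases i with ⟨v, j⟩
    fin_cases j
    · exact continuous_const
    · simp only [Fin.mk_one, extCornerParam_apply_one]; exact continuous_subtype_val

/-- A sequence in `[0, 1)` converging to the laminated endpoint. -/
def belowOne (k : ℕ) : unitInterval :=
  ⟨1 - 1 / ((k : ℝ) + 2), by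
    constructor
    · rw [sub_nonneg, div_le_one (by positivity)]; linarith
    · rw [sub_le_self_iff]; positivity⟩

/-- The sequence stays below `1`. -/
theorem belowOne_lt_one (k : ℕ) : belowOne k < 1 := by
  change (1 - 1 / ((k : ℝ) + 2)) < 1
  have : (0 : ℝ) < 1 / ((k : ℝ) + 2) := by positivity
  linarith

/-- The sequence converges to `1`. -/
theorem tendsto_belowOne : Tendsto belowOne atTop (𝓝 1) := by
  rw [tendsto_subtype_rng]
  change Tendsto (fun k : ℕ => (1 - 1 / ((k : ℝ) + 2))) atTop (𝓝 (1 : ℝ))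
  have h := (tendsto_one_div_add_atTop_nhds_zero_nat (𝕜 := ℝ)).comp (tendsto_add_atTop_nat 1)
  have h' : Tendsto (fun k : ℕ => 1 / ((k : ℝ) + 2)) atTop (𝓝 0) := by
    refine h.congr fun k => ?_
    simp only [Function.comp_apply]; push_cast; ring
  simpa using (tendsto_const_nhds (x := (1 : ℝ))).sub h'

/-- **Uniformity is load-bearing.** Even with the laminated endpoint EXCLUDED, no constants serve
the half-open extended segment `s ∈ [0, 1)` at aspect ratio `8`: crossing probabilities of a fixed
box are continuous in `s` (finite volume), so uniform bounds on `[0, 1)` would pass to `s = 1`,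
where `laminated_hardWay_le` forbids them. (Numerically each `M_s`, `s < 1`, looks box-crossing
with constants degenerating as `s → 1`; so positivity of RSW constants is NOT a consequence of the
soft structure shared by the whole family, and uniform constants on the FKG segment must come from
a quantitative use of `t ≤ 1`.) -/
theorem not_uniform_boxCrossingBounds_below_lamination :
    ¬ ∃ c > 0, ∃ n₀ : ℕ, ∀ s : unitInterval, s < 1 →
      BoxCrossingBounds (extCornerPercolation s) squareLatticeEmbedding.z 8 c n₀ := by
  rintro ⟨c, hc, n₀, h⟩
  obtain ⟨N, hN⟩ := (tendsto_laminated_bound.eventually (gt_mem_nhds hc)).exists_forall_of_atTop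
  set n := max N n₀ with hn
  set E := embRectCrossing (fun v => squareLatticeEmbedding.z v - 0) (8 * n) n with hE
  -- along `belowOne k → 1` the crossing probabilities are `≥ c` and converge to the value at `1`
  have hk : ∀ k, c ≤ (extCornerPercolation (belowOne k)).real E := fun k =>
    (h (belowOne k) (belowOne_lt_one k) n (le_max_right _ _) 0).1.1
  have hlim : Tendsto (fun k => (extCornerPercolation (belowOne k)).real E) atTop
      (𝓝 ((extCornerPercolation 1).real E)) :=
    ((continuous_extCornerPercolation_real_embRectCrossing 0 (8 * n) n).tendsto 1).comp
      tendsto_belowOne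
  have h1 : c ≤ (extCornerPercolation 1).real E := ge_of_tendsto' hlim hk
  have h2 := laminated_hardWay_le 0 n
  have h3 := hN n (le_max_left _ _)
  linarith

/-! ### The soft structure persists on the whole extended family: invariances, self-duality and
exact-`1/2` squares for `extCornerPercolation s`, every `s ∈ [0, 1]` -/

/-- Probabilities of measurable events under `M_s` are `prodBernoulli`-probabilities of their
preimages under the corner map. -/
theorem extCornerPercolation_apply (s : unitInterval) {A : Set (BondConfig (Site 2))}
    (hA : MeasurableSet A) :
    extCornerPercolation s A = prodBernoulli (extCornerParam s) (cornerConfig ⁻¹' A) :=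
  Measure.map_apply measurable_cornerConfig hA

/-- `M_s` is carried by configurations of lattice edges. -/
theorem extCornerPercolation_subset_edgeSet (s : unitInterval) :
    ∀ᵐ ω ∂(extCornerPercolation s), ω ⊆ (zdGraph 2).edgeSet := by
  have hmeas : MeasurableSet {ω : BondConfig (Site 2) | ω ⊆ (zdGraph 2).edgeSet} := by
    have h : {ω : BondConfig (Site 2) | ω ⊆ (zdGraph 2).edgeSet} =
        ⋂ e ∈ ((zdGraph 2).edgeSet)ᶜ, {ω | e ∉ ω} := by
      ext ω
      simp only [Set.mem_setOf_eq, Set.mem_iInter, Set.mem_compl_iff]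
      exact ⟨fun h e he heω => he (h heω), fun h e heω => by_contra fun he => h e he heω⟩
    rw [h]
    exact MeasurableSet.biInter (Set.to_countable _) fun e _ => (measurableSet_mem e).compl
  rw [ae_iff, ← Set.compl_setOf, extCornerPercolation_apply s hmeas.compl]
  have h : cornerConfig ⁻¹' {ω : BondConfig (Site 2) | ω ⊆ (zdGraph 2).edgeSet}ᶜ = ∅ := by
    ext S
    simp only [Set.preimage_compl, Set.mem_compl_iff, Set.mem_preimage, Set.mem_setOf_eq,
      Set.mem_empty_iff_false, iff_false, not_not]
    exact cornerConfig_subset_edgeSet S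
  rw [h, measure_empty]

/-- Vertex relabellings preserve `prodBernoulli (extCornerParam s)` (the parameters do not depend
on the vertex). -/
theorem prodBernoulli_extCornerParam_map_vertexReindex (s : unitInterval) (π : Site 2 ≃ Site 2) :
    (prodBernoulli (extCornerParam s)).map (vertexReindex π) =
      prodBernoulli (extCornerParam s) := by
  have h : vertexReindex π = fun S => (Equiv.prodCongr π (Equiv.refl (Fin 2))).symm '' S :=
    funext (vertexReindex_eq_image π)
  rw [h]
  exact prodBernoulli_map_image_equiv _ _ fun _ => rfl

/-- Block maps by an involution of `{0,1}²` fixing the splitting bit preserve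
`prodBernoulli (extCornerParam s)`: they permute, for each value of the splitting bit, the two
values of the FAIR coin — the only feature of the corner law they use. -/
theorem prodBernoulli_extCornerParam_map_blockMap (s : unitInterval)
    {Φ : (Fin 2 → Prop) → (Fin 2 → Prop)} (hΦ : Function.Involutive Φ) (h1 : ∀ g, Φ g 1 = g 1) :
    (prodBernoulli (extCornerParam s)).map (blockMap Φ) = prodBernoulli (extCornerParam s) := by
  refine prodBernoulli_map_blockMap _ _ Φ fun v => ?_
  refine map_eq_self_of_involutive _ hΦ fun g => ?_
  rw [Measure.pi_singleton, Measure.pi_singleton, Fin.prod_univ_two, Fin.prod_univ_two, h1 g,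
    extCornerParam_apply_zero, bernoulli_half_singleton, bernoulli_half_singleton]

/-- Invariance principle for `M_s` (as `cornerPercolation_map_eq_of_comm`). -/
theorem extCornerPercolation_map_eq_of_comm (s : unitInterval)
    {F : BondConfig (Site 2) → BondConfig (Site 2)} (hF : Measurable F)
    {G : Set (Site 2 × Fin 2) → Set (Site 2 × Fin 2)} (hG : Measurable G)
    (hlaw : (prodBernoulli (extCornerParam s)).map G = prodBernoulli (extCornerParam s))
    (hcomm : ∀ S, F (cornerConfig S) = cornerConfig (G S)) :
    (extCornerPercolation s).map F = extCornerPercolation s := by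
  rw [extCornerPercolation, Measure.map_map hF measurable_cornerConfig,
    show F ∘ cornerConfig = cornerConfig ∘ G from funext hcomm,
    ← Measure.map_map measurable_cornerConfig hG, hlaw]

/-- Transfer principle for `M_s` (as `cornerPercolation_map_eq_map_of_comm`). -/
theorem extCornerPercolation_map_eq_map_of_comm (s : unitInterval)
    {F F' : BondConfig (Site 2) → BondConfig (Site 2)} (hF : Measurable F) (hF' : Measurable F')
    {G : Set (Site 2 × Fin 2) → Set (Site 2 × Fin 2)} (hG : Measurable G)
    (hlaw : (prodBernoulli (extCornerParam s)).map G = prodBernoulli (extCornerParam s))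
    (hcomm : ∀ S, F (cornerConfig S) = F' (cornerConfig (G S))) :
    (extCornerPercolation s).map F = (extCornerPercolation s).map F' := by
  rw [extCornerPercolation, Measure.map_map hF measurable_cornerConfig,
    show F ∘ cornerConfig = (F' ∘ cornerConfig) ∘ G from funext hcomm,
    ← Measure.map_map (hF'.comp measurable_cornerConfig) hG, hlaw,
    Measure.map_map hF' measurable_cornerConfig]

/-- **Translation invariance of `M_s`.** -/
theorem extCornerPercolation_map_relabel_shift (s : unitInterval) (a : Site 2) :
    (extCornerPercolation s).map (BondConfig.relabel (sym2Equiv (Site.shift a))) =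
      extCornerPercolation s :=
  extCornerPercolation_map_eq_of_comm s (MeasurableEquiv.measurable _) (measurable_vertexReindex _)
    (prodBernoulli_extCornerParam_map_vertexReindex s _) (relabel_shift_cornerConfig a)

/-- Applied form: `M_s {ω | ω + a ∈ A} = M_s(A)`. -/
theorem extCornerPercolation_real_preimage_relabel_shift (s : unitInterval) (a : Site 2)
    (A : Set (BondConfig (Site 2))) :
    (extCornerPercolation s).real (BondConfig.relabel (sym2Equiv (Site.shift a)) ⁻¹' A) =
      (extCornerPercolation s).real A := by
  rw [measureReal_def, measureReal_def, ← MeasurableEquiv.map_apply,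
    extCornerPercolation_map_relabel_shift]

/-- **`M_s` is invariant under the transposition of the axes** (the diagonal reflection). -/
theorem extCornerPercolation_map_relabel_transpose (s : unitInterval) :
    (extCornerPercolation s).map (BondConfig.relabel (sym2Equiv transposeIso.toEquiv)) =
      extCornerPercolation s := by
  rw [transposeIso_toEquiv]
  refine extCornerPercolation_map_eq_of_comm s (MeasurableEquiv.measurable _)
    ((measurable_blockMap _).comp (measurable_vertexReindex _)) ?_ relabel_transpose_cornerConfig
  rw [← Measure.map_map (measurable_blockMap _) (measurable_vertexReindex _),
    prodBernoulli_extCornerParam_map_vertexReindex,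
    prodBernoulli_extCornerParam_map_blockMap s transposeBit_involutive transposeBit_one]

/-- Applied form: `M_s {ω | ωᵀ ∈ A} = M_s(A)`. -/
theorem extCornerPercolation_real_preimage_relabel_transpose (s : unitInterval)
    (A : Set (BondConfig (Site 2))) :
    (extCornerPercolation s).real (BondConfig.relabel (sym2Equiv transposeIso.toEquiv) ⁻¹' A) =
      (extCornerPercolation s).real A := by
  rw [measureReal_def, measureReal_def, ← MeasurableEquiv.map_apply,
    extCornerPercolation_map_relabel_transpose]

/-- **Self-duality of `M_s`** for every `s`: the law of the dual configuration is the law of the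
point-reflected configuration. -/
theorem extCornerPercolation_map_dualConfig (s : unitInterval) :
    (extCornerPercolation s).map dualConfig =
      (extCornerPercolation s).map (BondConfig.relabel (sym2Equiv (Equiv.neg (Site 2)))) := by
  refine extCornerPercolation_map_eq_map_of_comm s measurable_dualConfig
    (MeasurableEquiv.measurable _) ((measurable_blockMap _).comp (measurable_vertexReindex _)) ?_
    dualConfig_cornerConfig
  rw [← Measure.map_map (measurable_blockMap _) (measurable_vertexReindex _),
    prodBernoulli_extCornerParam_map_vertexReindex,
    prodBernoulli_extCornerParam_map_blockMap s dualBit_involutive dualBit_one]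

/-- Applied form of self-duality: `M_s {ω | dualConfig ω ∈ A} = M_s {ω | -ω ∈ A}`. -/
theorem extCornerPercolation_real_preimage_dualConfig (s : unitInterval)
    {A : Set (BondConfig (Site 2))} (hA : MeasurableSet A) :
    (extCornerPercolation s).real (dualConfig ⁻¹' A) =
      (extCornerPercolation s).real
        (BondConfig.relabel (sym2Equiv (Equiv.neg (Site 2))) ⁻¹' A) := by
  rw [measureReal_def, measureReal_def, ← Measure.map_apply measurable_dualConfig hA,
    extCornerPercolation_map_dualConfig, MeasurableEquiv.map_apply]

/-- `M_s(LR(m, n)) + M_s(TB*(m, n)) = 1`. -/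
theorem extCornerPercolation_real_lrCrossing_add_dualTBCrossing (s : unitInterval) (m n : ℕ) :
    (extCornerPercolation s).real (lrCrossing m n) +
      (extCornerPercolation s).real (dualTBCrossing m n) = 1 := by
  set μ := extCornerPercolation s
  have hae : ∀ᵐ ω ∂μ, ω ⊆ (zdGraph 2).edgeSet := extCornerPercolation_subset_edgeSet s
  have hunion : μ.real (lrCrossing m n ∪ dualTBCrossing m n) = 1 := by
    rw [← probReal_univ (μ := μ)]
    refine measureReal_congr (ae_eq_univ.2 ?_)
    rw [measure_eq_zero_iff_ae_notMem]
    filter_upwards [hae] with ω hω hn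
    rcases lrCrossing_xor_dualTBCrossing_holds m n hω with h | h
    · exact hn (Or.inl h.1)
    · exact hn (Or.inr h.1)
  have hinter : μ.real (lrCrossing m n ∩ dualTBCrossing m n) = 0 := by
    rw [measureReal_def, measure_eq_zero_iff_ae_notMem.2, ENNReal.toReal_zero]
    filter_upwards [hae] with ω hω hn
    rcases lrCrossing_xor_dualTBCrossing_holds m n hω with h | h
    · exact h.2 hn.2
    · exact h.2 hn.1
  have h := measureReal_union_add_inter (μ := μ) (s := lrCrossing m n)
    (measurableSet_dualTBCrossing m n)
  rw [hunion, hinter, add_zero] at h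
  exact h.symm

/-- Translated open crossing events have the same `M_s`-probability. -/
theorem extCornerPercolation_real_openCrossing_shift (s : unitInterval) (v : Site 2)
    (S A B : Set (Site 2)) :
    (extCornerPercolation s).real (openCrossing ((· + v) '' S) ((· + v) '' A) ((· + v) '' B)) =
      (extCornerPercolation s).real (openCrossing S A B) := by
  rw [← preimage_relabel_openCrossing (Site.shift v) S A B,
    extCornerPercolation_real_preimage_relabel_shift]
  rfl

/-- `M_s(TB([0, n] × [0, m])) = M_s(LR([0, m] × [0, n]))`. -/
theorem extCornerPercolation_real_tbCrossing (s : unitInterval) (m n : ℕ) :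
    (extCornerPercolation s).real (tbCrossing n m) =
      (extCornerPercolation s).real (lrCrossing m n) := by
  rw [← preimage_relabel_transpose_tbCrossing m n,
    extCornerPercolation_real_preimage_relabel_transpose]

/-- `M_s(TB*(m + 1, n)) = M_s(LR([0, n + 1] × [0, m]))`. -/
theorem extCornerPercolation_real_dualTBCrossing_succ (s : unitInterval) (m n : ℕ) :
    (extCornerPercolation s).real (dualTBCrossing (m + 1) n) =
      (extCornerPercolation s).real (lrCrossing (n + 1) m) := by
  have hX : MeasurableSet (openCrossing (↑(dualRectangle (m + 1) n) : Set (Site 2))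
      ↑(dualTopSide (m + 1) n) ↑(dualBottomSide (m + 1) n)) := measurableSet_openCrossing _ _ _
  rw [dualTBCrossing, extCornerPercolation_real_preimage_dualConfig s hX,
    ← negEquiv_image_rectangle, ← negEquiv_image_bottomSide, ← negEquiv_image_topSide,
    preimage_relabel_openCrossing (Equiv.neg (Site 2)),
    extCornerPercolation_real_openCrossing_shift,
    ← extCornerPercolation_real_tbCrossing s (n + 1) m]
  rfl

/-- **Complementary rectangles** for every `s`:
`M_s(LR([0, m + 1] × [0, n])) + M_s(LR([0, n + 1] × [0, m])) = 1`. -/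
theorem extCornerPercolation_real_lrCrossing_add (s : unitInterval) (m n : ℕ) :
    (extCornerPercolation s).real (lrCrossing (m + 1) n) +
      (extCornerPercolation s).real (lrCrossing (n + 1) m) = 1 := by
  rw [← extCornerPercolation_real_dualTBCrossing_succ s m n]
  exact extCornerPercolation_real_lrCrossing_add_dualTBCrossing s (m + 1) n

/-- **`M_s` crosses the `(n + 1) × n` rectangle with probability EXACTLY `1/2`, for every
`s ∈ [0, 1]`** — in particular at the laminated endpoint `s = 1`, where box crossing fails
(`not_hasBoxCrossingProperty_laminated`): exact-`1/2` squares, self-duality, translation and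
diagonal-reflection invariance do not imply the box-crossing property. -/
theorem extCornerPercolation_real_lrCrossing_succ_self (s : unitInterval) (n : ℕ) :
    (extCornerPercolation s).real (lrCrossing (n + 1) n) = 1 / 2 := by
  have h := extCornerPercolation_real_lrCrossing_add s n n
  linarith

/-- **Capstone (no-go form).** There is a probability measure on bond configurations of `ℤ²` —
the laminated corner model `extCornerPercolation 1`, a range-1 block factor of i.i.d. fair coins —
that is translation invariant, invariant under the diagonal reflection, self-dual (law of the
dual configuration = law of the point-reflected configuration), crosses EVERY `(n + 1) × n`
lattice rectangle with probability exactly `1/2`, and yet does NOT have the box-crossing property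
on `√2 ℤ²`. Hence no argument from these properties alone proves `UniformBoxCrossing`. -/
theorem exists_selfDual_symmetric_exactHalf_not_boxCrossing :
    ∃ μ : Measure (BondConfig (Site 2)), IsProbabilityMeasure μ ∧
      (∀ a : Site 2, μ.map (BondConfig.relabel (sym2Equiv (Site.shift a))) = μ) ∧
      μ.map (BondConfig.relabel (sym2Equiv transposeIso.toEquiv)) = μ ∧
      μ.map dualConfig = μ.map (BondConfig.relabel (sym2Equiv (Equiv.neg (Site 2)))) ∧
      (∀ n : ℕ, μ.real (lrCrossing (n + 1) n) = 1 / 2) ∧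
      ¬ HasBoxCrossingProperty μ squareLatticeEmbedding.z :=
  ⟨extCornerPercolation 1, inferInstance, extCornerPercolation_map_relabel_shift 1,
    extCornerPercolation_map_relabel_transpose 1, extCornerPercolation_map_dualConfig 1,
    extCornerPercolation_real_lrCrossing_succ_self 1, not_hasBoxCrossingProperty_laminated⟩

/-! ### The kernel stub `stub_nonSlant` also fails beyond FKG: Non-Slant dies at the laminated
endpoint -/

/-- Orbit events with MANY north steps are covered by the cylinders of large patterns. -/
theorem orbitEvent_ge_subset (x : Site 2) (K : ℕ) (n : ℕ) :
    {S : Set (Site 2 × Fin 2) | x 1 + n ≤ lamOrbit (coins S) x K 1} ⊆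
      ⋃ s ∈ (Finset.univ : Finset (Finset (Fin K))).filter (fun s => n ≤ s.card), patCyl x s := by
  intro S hS
  simp only [Set.mem_setOf_eq, lamOrbit_apply_one_eq] at hS
  simp only [Set.mem_iUnion, Finset.mem_filter, Finset.mem_univ, true_and, exists_prop]
  exact ⟨patOf S x K, by exact_mod_cast (by linarith : (n : ℤ) ≤ (patOf S x K).card),
    mem_patCyl_patOf S x K⟩

/-- Counting large patterns by weighting: `y^(K-n) · #{s ⊆ Fin K : n ≤ |s|} ≤ (1 + y)^K` for
`0 < y ≤ 1`. -/
theorem card_filter_le_card_mul_le (K n : ℕ) {y : ℝ} (hy0 : 0 < y) (hy1 : y ≤ 1) :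
    y ^ (K - n) *
        (((Finset.univ : Finset (Finset (Fin K))).filter (fun s => n ≤ s.card)).card : ℝ) ≤
      (1 + y) ^ K := by
  set A := (Finset.univ : Finset (Finset (Fin K))).filter (fun s => n ≤ s.card) with hA
  have h1 : y ^ (K - n) * (A.card : ℝ) = ∑ s ∈ A, y ^ (K - n) := by
    rw [Finset.sum_const, nsmul_eq_mul, mul_comm]
  have h2 : ∑ s ∈ A, y ^ (K - n) ≤ ∑ s ∈ A, (1 : ℝ) ^ s.card * y ^ (K - s.card) := by
    refine Finset.sum_le_sum fun s hs => ?_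
    have hsn : n ≤ s.card := (Finset.mem_filter.1 hs).2
    rw [one_pow, one_mul]
    exact pow_le_pow_of_le_one hy0.le hy1 (by omega)
  have h3 : ∑ s ∈ A, (1 : ℝ) ^ s.card * y ^ (K - s.card) ≤
      ∑ s : Finset (Fin K), (1 : ℝ) ^ s.card * y ^ (K - s.card) :=
    Finset.sum_le_sum_of_subset_of_nonneg (Finset.filter_subset _ _) fun _ _ _ => by positivity
  rw [h1, ← Fin.sum_pow_mul_eq_add_pow (n := K) (1 : ℝ) y]
  exact h2.trans h3

/-- **Orbit bound, upper tail**: with fair coins, the orbit of `x` makes at least `5m` north steps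
among its first `9m` steps with probability at most `((9/10)^9 (5/4)^4)^m`
(weighting with `y = 4/5`). -/
theorem real_orbitEvent_ge_le (p : Site 2 × Fin 2 → unitInterval) (hp : ∀ v, p (v, 0) = half)
    (x : Site 2) (m : ℕ) :
    (prodBernoulli p).real {S | x 1 + 5 * m ≤ lamOrbit (coins S) x (9 * m) 1} ≤
      ((9 / 10 : ℝ) ^ 9 * (5 / 4 : ℝ) ^ 4) ^ m := by
  classical
  have hcount := card_filter_le_card_mul_le (9 * m) (5 * m) (y := (4 / 5 : ℝ)) (by norm_num)
    (by norm_num)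
  have hsub : 9 * m - 5 * m = 4 * m := by omega
  rw [hsub, show (1 + 4 / 5 : ℝ) = 9 / 5 by norm_num] at hcount
  set A := (Finset.univ : Finset (Finset (Fin (9 * m)))).filter (fun s => 5 * m ≤ s.card) with hA
  have h54 : (5 / 4 : ℝ) ^ (4 * m) * (4 / 5 : ℝ) ^ (4 * m) = 1 := by rw [← mul_pow]; norm_num
  have hcard : (A.card : ℝ) ≤ (5 / 4 : ℝ) ^ (4 * m) * (9 / 5 : ℝ) ^ (9 * m) :=
    calc (A.card : ℝ) = (5 / 4 : ℝ) ^ (4 * m) * ((4 / 5 : ℝ) ^ (4 * m) * A.card) := by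
          rw [← mul_assoc, h54, one_mul]
      _ ≤ (5 / 4 : ℝ) ^ (4 * m) * (9 / 5 : ℝ) ^ (9 * m) := by gcongr
  calc (prodBernoulli p).real {S | x 1 + 5 * m ≤ lamOrbit (coins S) x (9 * m) 1}
      ≤ (prodBernoulli p).real (⋃ s ∈ A, patCyl x s) :=
        measureReal_mono (orbitEvent_ge_subset x (9 * m) (5 * m)) (measure_ne_top _ _)
    _ ≤ ∑ s ∈ A, (prodBernoulli p).real (patCyl x s) := measureReal_biUnion_finset_le _ _
    _ = A.card * (1 / 2 : ℝ) ^ (9 * m) := by simp [real_patCyl p hp, Finset.sum_const]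
    _ ≤ ((5 / 4 : ℝ) ^ (4 * m) * (9 / 5 : ℝ) ^ (9 * m)) * (1 / 2 : ℝ) ^ (9 * m) := by gcongr
    _ = ((9 / 10 : ℝ) ^ 9 * (5 / 4 : ℝ) ^ 4) ^ m := by
        rw [pow_mul, pow_mul, pow_mul, ← mul_pow, ← mul_pow]
        congr 1
        norm_num

/-- A run of `d` heads to the east of `y`: a cylinder of probability `(1/2)^d`. -/
theorem real_eastRun (p : Site 2 × Fin 2 → unitInterval) (hp : ∀ v, p (v, 0) = half)
    (y : Site 2) (d : ℕ) :
    (prodBernoulli p).real {S | ∀ i : Fin d, (y + ![((i : ℕ) : ℤ), 0], (0 : Fin 2)) ∈ S} =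
      (1 / 2 : ℝ) ^ d := by
  have hφ : Function.Injective fun i : Fin d => (y + ![((i : ℕ) : ℤ), 0], (0 : Fin 2)) := by
    intro i j h
    simp only [Prod.mk.injEq, and_true, add_right_inj] at h
    have := congrFun h 0
    simp only [Matrix.cons_val_zero, Nat.cast_inj] at this
    exact Fin.ext this
  have h := prodBernoulli_real_cylinder_of_injective p hφ (fun _ => True)
  simp only [iff_true] at h
  rw [h]
  simp only [hp, Finset.prod_const, Finset.card_univ, Fintype.card_fin]
  congr 1
  have := ber_half_real_iff True
  simp only [iff_true] at this
  exact this

/-- Along an orbit segment without north steps the orbit moves east through heads. -/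
theorem lamOrbit_flat_run (c : Set (Site 2)) (y : Site 2) {L : ℕ}
    (hflat : lamOrbit c y L 1 = y 1) :
    ∀ i, i < L → lamOrbit c y i = y + ![(i : ℤ), 0] ∧ lamOrbit c y i ∈ c := by
  have hle : ∀ i, i ≤ L → lamOrbit c y i 1 = y 1 := fun i hi =>
    le_antisymm (hflat ▸ lamOrbit_one_mono c y hi) (le_lamOrbit_one c y i)
  intro i hi
  have hpos : lamOrbit c y i = y + ![(i : ℤ), 0] := by
    have hs := lamOrbit_sum c y i
    have h1 := hle i hi.le
    funext j
    fin_cases j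
    · simp only [Fin.zero_eta, Pi.add_apply, Matrix.cons_val_zero]; omega
    · simp only [Fin.mk_one, Pi.add_apply, Matrix.cons_val_one, Matrix.cons_val_zero]; omega
  refine ⟨hpos, ?_⟩
  by_contra hc
  have hstep : lamOrbit c y (i + 1) 1 = lamOrbit c y i 1 + 1 := by
    rw [lamOrbit_succ, lamStep_apply_one, if_neg hc]
  have := hle (i + 1) hi
  have := hle i hi.le
  omega

/-- `|bottomSide m n| ≤ m + 1` (the tree's `card_bottomSide_le`, re-proved to keep imports
light). -/
theorem card_bottomSide_le' (m n : ℕ) : (bottomSide m n).card ≤ m + 1 := by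
  have hsub : bottomSide m n ⊆ (Finset.range (m + 1)).image
      fun t : ℕ => (![(t : ℤ), 0] : Site 2) := by
    intro x hx
    simp only [bottomSide, Finset.mem_filter, mem_rectangle_iff] at hx
    obtain ⟨⟨h0, h1, -, -⟩, hx1⟩ := hx
    refine Finset.mem_image.2 ⟨(x 0).toNat, Finset.mem_range.2 (by omega), ?_⟩
    ext i; fin_cases i
    · simp only [Fin.zero_eta, Matrix.cons_val_zero]; exact Int.toNat_of_nonneg h0
    · simp [hx1]
  exact (Finset.card_le_card hsub).trans (Finset.card_image_le.trans (Finset.card_range _).le)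

/-- `|topSide m n| ≤ m + 1`. -/
theorem card_topSide_le (m n : ℕ) : (topSide m n).card ≤ m + 1 := by
  have hsub : topSide m n ⊆ (Finset.range (m + 1)).image
      fun t : ℕ => (![(t : ℤ), (n : ℤ)] : Site 2) := by
    intro x hx
    simp only [topSide, Finset.mem_filter, mem_rectangle_iff] at hx
    obtain ⟨⟨h0, h1, -, -⟩, hx1⟩ := hx
    refine Finset.mem_image.2 ⟨(x 0).toNat, Finset.mem_range.2 (by omega), ?_⟩
    ext i; fin_cases i
    · simp only [Fin.zero_eta, Matrix.cons_val_zero]; exact Int.toNat_of_nonneg h0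
    · simp [hx1]
  exact (Finset.card_le_card hsub).trans (Finset.card_image_le.trans (Finset.card_range _).le)

/-- **Deterministic core for Non-Slant at the laminated endpoint.** If the laminated configuration
has an open path inside `[0, 5m]²` from a bottom vertex `x` to a top vertex `y` with
`5 |y₀ - x₀| ≤ 3 · 5m`, then either the orbit of some bottom vertex makes `≥ 5m` north steps among
its first `9m` steps, or some top vertex starts a run of `m + 1` heads to its east. -/
theorem lam_nonSlant_alternative (c : Set (Site 2)) (m : ℕ)
    (h : ∃ x ∈ bottomSide (5 * m) (5 * m), ∃ y ∈ topSide (5 * m) (5 * m),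
      5 * |y 0 - x 0| ≤ 3 * ((5 * m : ℕ) : ℤ) ∧
        lamConfig c ∈ openConnIn (↑(rectangle (5 * m) (5 * m))) x y) :
    (∃ x ∈ bottomSide (5 * m) (5 * m), x 1 + 5 * m ≤ lamOrbit c x (9 * m) 1) ∨
      (∃ y ∈ topSide (5 * m) (5 * m), ∀ i : Fin (m + 1), lamOrbit c y i ∈ c ∧
        lamOrbit c y i = y + ![((i : ℕ) : ℤ), 0]) := by
  classical
  obtain ⟨x, hx, y, hy, hslant, hxT, hyT, hreach⟩ := h
  obtain ⟨W⟩ := hreach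
  set p := W.toPath with hp
  obtain ⟨k, hk, hasc, hdesc⟩ := path_unimodal c _ p.1 p.2
  have hx1 : x 1 = 0 := (Finset.mem_filter.1 hx).2
  have hy1 : y 1 = 5 * m := by
    have := (Finset.mem_filter.1 hy).2; exact_mod_cast this
  -- the peak `mm`
  set mm := lamOrbit c x k with hmm
  have hpeak_x : (p.1.getVert k : Site 2) = mm := hasc k le_rfl
  have hpeak_y : mm = lamOrbit c y (p.1.length - k) := by rw [← hpeak_x, hdesc k le_rfl hk]
  have hmmT : mm ∈ (↑(rectangle (5 * m) (5 * m)) : Set (Site 2)) := by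
    rw [← hpeak_x]; exact (p.1.getVert k).2
  have hmm1 : mm 1 = 5 * m := by
    have h1 : mm 1 ≤ 5 * m := by
      have := (mem_rectangle_iff.1 (Finset.mem_coe.1 hmmT)).2.2.2; exact_mod_cast this
    have h2 : y 1 ≤ mm 1 := by rw [hpeak_y]; exact le_lamOrbit_one c y _
    omega
  have hsum := lamOrbit_sum c x k
  rw [← hmm] at hsum
  -- east count at the peak
  by_cases hE : mm 0 - x 0 ≤ 4 * m
  · left
    refine ⟨x, hx, ?_⟩
    have hk9 : k ≤ 9 * m := by
      have : (k : ℤ) ≤ 9 * m := by omega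
      exact_mod_cast this
    calc x 1 + 5 * m = mm 1 := by omega
      _ ≤ lamOrbit c x (9 * m) 1 := lamOrbit_one_mono c x hk9
  · right
    refine ⟨y, hy, ?_⟩
    push Not at hE
    -- the descent from the peak to `y` is a flat run of length `mm 0 - y 0 > m`
    have hflat : lamOrbit c y (p.1.length - k) 1 = y 1 := by rw [← hpeak_y]; omega
    have hlen : (m : ℤ) + 1 ≤ (p.1.length - k : ℕ) := by
      have hs := lamOrbit_sum c y (p.1.length - k)
      rw [← hpeak_y] at hs
      have habs : y 0 - x 0 ≤ 3 * m := by
        have := abs_le.1 (show |y 0 - x 0| ≤ 3 * m by omega)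
        omega
      omega
    intro i
    have hi : (i : ℕ) < p.1.length - k := by
      have := i.2; omega
    obtain ⟨hpos, hc⟩ := lamOrbit_flat_run c y hflat i hi
    exact ⟨hc, hpos⟩

/-- **Non-Slant fails at the laminated endpoint.** The `extCornerPercolation 1`-probability of
B–R's Non-Slant event in `[0, 5m]²` (a top–bottom open path whose endpoint abscissae differ by at
most `3/5` of the side) is at most `(5m + 1) (((9/10)^9 (5/4)^4)^m + (1/2)^(m+1))`. -/
theorem laminated_nonSlant_le (m : ℕ) :
    (extCornerPercolation 1).real {ω | ∃ x ∈ bottomSide (5 * m) (5 * m),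
        ∃ y ∈ topSide (5 * m) (5 * m), 5 * |y 0 - x 0| ≤ 3 * ((5 * m : ℕ) : ℤ) ∧
          ω ∈ openConnIn (↑(rectangle (5 * m) (5 * m))) x y} ≤
      (5 * m + 1) * (((9 / 10 : ℝ) ^ 9 * (5 / 4 : ℝ) ^ 4) ^ m + (1 / 2 : ℝ) ^ (m + 1)) := by
  classical
  set n := 5 * m with hn
  set E : Set (BondConfig (Site 2)) := {ω | ∃ x ∈ bottomSide n n, ∃ y ∈ topSide n n,
    5 * |y 0 - x 0| ≤ 3 * ((n : ℕ) : ℤ) ∧ ω ∈ openConnIn (↑(rectangle n n)) x y} with hE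
  have hEm : MeasurableSet E := by
    have : E = ⋃ x ∈ bottomSide n n, ⋃ y ∈ topSide n n,
        ({ω : BondConfig (Site 2) | 5 * |y 0 - x 0| ≤ 3 * ((n : ℕ) : ℤ)} ∩
          openConnIn (↑(rectangle n n)) x y) := by
      ext ω
      simp only [hE, Set.mem_setOf_eq, Set.mem_iUnion, Set.mem_inter_iff, exists_prop]
    rw [this]
    refine MeasurableSet.biUnion (Finset.countable_toSet _) fun x _ =>
      MeasurableSet.biUnion (Finset.countable_toSet _) fun y _ =>
        (MeasurableSet.const _).inter (measurableSet_openConnIn_of_countable _ _ _)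
  rw [extCornerPercolation, map_measureReal_apply measurable_cornerConfig hEm]
  set μ := prodBernoulli (extCornerParam 1) with hμ
  set G : Set (Set (Site 2 × Fin 2)) := {S | ∀ v, (v, (1 : Fin 2)) ∈ S} with hG
  set B₁ : Site 2 → Set (Set (Site 2 × Fin 2)) :=
    fun x => {S | x 1 + 5 * m ≤ lamOrbit (coins S) x (9 * m) 1} with hB₁
  set B₂ : Site 2 → Set (Set (Site 2 × Fin 2)) :=
    fun y => {S | ∀ i : Fin (m + 1), (y + ![((i : ℕ) : ℤ), 0], (0 : Fin 2)) ∈ S} with hB₂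
  have hsub : cornerConfig ⁻¹' E ⊆
      ((⋃ x ∈ bottomSide n n, B₁ x) ∪ (⋃ y ∈ topSide n n, B₂ y)) ∪ Gᶜ := by
    intro S hS
    by_cases hSG : S ∈ G
    · left
      have hlam : lamConfig (coins S) ∈ E := by
        have := cornerConfig_eq_lamConfig hSG
        rw [Set.mem_preimage, this] at hS
        exact hS
      rcases lam_nonSlant_alternative (coins S) m hlam with ⟨x, hx, hbad⟩ | ⟨y, hy, hrun⟩
      · left
        simp only [Set.mem_iUnion, exists_prop]
        exact ⟨x, hx, hbad⟩
      · right
        simp only [Set.mem_iUnion, exists_prop]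
        refine ⟨y, hy, fun i => ?_⟩
        have := (hrun i)
        rw [this.2] at this
        exact this.1
    · exact Or.inr hSG
  have hG0 : μ.real Gᶜ = 0 := by
    have h := ae_forall_splitting_mem
    rw [ae_iff] at h
    rw [measureReal_eq_zero_iff (measure_ne_top _ _)]
    exact h
  have hcardB : ((bottomSide n n).card : ℝ) ≤ 5 * m + 1 := by
    have := card_bottomSide_le' n n; rw [hn] at this ⊢; exact_mod_cast this
  have hcardT : ((topSide n n).card : ℝ) ≤ 5 * m + 1 := by
    have := card_topSide_le n n; rw [hn] at this ⊢; exact_mod_cast this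
  calc μ.real (cornerConfig ⁻¹' E)
      ≤ μ.real (((⋃ x ∈ bottomSide n n, B₁ x) ∪ (⋃ y ∈ topSide n n, B₂ y)) ∪ Gᶜ) :=
        measureReal_mono hsub (measure_ne_top _ _)
    _ ≤ μ.real ((⋃ x ∈ bottomSide n n, B₁ x) ∪ (⋃ y ∈ topSide n n, B₂ y)) + μ.real Gᶜ :=
        measureReal_union_le _ _
    _ ≤ (μ.real (⋃ x ∈ bottomSide n n, B₁ x) + μ.real (⋃ y ∈ topSide n n, B₂ y)) + 0 := by
        rw [hG0]; gcongr; exact measureReal_union_le _ _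
    _ ≤ (∑ x ∈ bottomSide n n, μ.real (B₁ x) + ∑ y ∈ topSide n n, μ.real (B₂ y)) + 0 := by
        gcongr <;> exact measureReal_biUnion_finset_le _ _
    _ ≤ (∑ x ∈ bottomSide n n, ((9 / 10 : ℝ) ^ 9 * (5 / 4 : ℝ) ^ 4) ^ m +
          ∑ y ∈ topSide n n, (1 / 2 : ℝ) ^ (m + 1)) + 0 := by
        gcongr with x hx y hy
        · exact real_orbitEvent_ge_le _ (fun v => extCornerParam_apply_zero 1 v) x m
        · exact (real_eastRun _ (fun v => extCornerParam_apply_zero 1 v) y (m + 1)).le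
    _ ≤ (5 * m + 1) * (((9 / 10 : ℝ) ^ 9 * (5 / 4 : ℝ) ^ 4) ^ m + (1 / 2 : ℝ) ^ (m + 1)) := by
        rw [Finset.sum_const, Finset.sum_const, add_zero, nsmul_eq_mul, nsmul_eq_mul]
        have h1 : (0 : ℝ) ≤ ((9 / 10 : ℝ) ^ 9 * (5 / 4 : ℝ) ^ 4) ^ m := by positivity
        have h2 : (0 : ℝ) ≤ (1 / 2 : ℝ) ^ (m + 1) := by positivity
        nlinarith

/-- The Non-Slant lamination bound tends to `0`. -/
theorem tendsto_laminated_nonSlant_bound :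
    Tendsto (fun m : ℕ => (5 * m + 1) *
      (((9 / 10 : ℝ) ^ 9 * (5 / 4 : ℝ) ^ 4) ^ m + (1 / 2 : ℝ) ^ (m + 1))) atTop (𝓝 0) := by
  set r : ℝ := (9 / 10 : ℝ) ^ 9 * (5 / 4 : ℝ) ^ 4 with hr
  have hr0 : 0 ≤ r := by positivity
  have hr1 : r < 1 := by norm_num [hr]
  have h1 := tendsto_self_mul_const_pow_of_lt_one hr0 hr1
  have h2 := tendsto_pow_atTop_nhds_zero_of_lt_one hr0 hr1
  have h3 := tendsto_self_mul_const_pow_of_lt_one (r := (1 / 2 : ℝ)) (by norm_num) (by norm_num)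
  have h4 := tendsto_pow_atTop_nhds_zero_of_lt_one (r := (1 / 2 : ℝ)) (by norm_num) (by norm_num)
  have h := ((h1.const_mul 5).add h2).add (((h3.const_mul 5).add h4).mul_const (1 / 2))
  simp only [mul_zero, add_zero, zero_mul] at h
  refine h.congr fun m => ?_
  rw [pow_succ]
  ring

/-- **The kernel stub beyond FKG is false**: `stub_nonSlant` of line `Sketch` with
`cornerPercolation t, t ∈ [0,1]` replaced by `extCornerPercolation s, s ∈ [0,1]` fails (witness
`s = 1`, squares of side `5m`). So the Non-Slant kernel, like the crux, can only be proved by a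
quantitative use of `t ≤ 1` (no shear-blind / FKG-free argument reaches it). -/
theorem nonSlant_false_without_FKG :
    ¬ ∃ c : ℝ, 0 < c ∧ ∃ n₀ : ℕ, ∀ (s : unitInterval) (n : ℕ), n₀ ≤ n →
      c ≤ (extCornerPercolation s).real {ω | ∃ x ∈ bottomSide n n, ∃ y ∈ topSide n n,
        5 * |y 0 - x 0| ≤ 3 * (n : ℤ) ∧ ω ∈ openConnIn (↑(rectangle n n)) x y} := by
  rintro ⟨c, hc, n₀, h⟩
  obtain ⟨M, hM⟩ :=
    (tendsto_laminated_nonSlant_bound.eventually (gt_mem_nhds hc)).exists_forall_of_atTop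
  set m := max M n₀ with hm
  have h1 := h 1 (5 * m) (by omega)
  have h2 := laminated_nonSlant_le m
  have h3 := hM m (le_max_left _ _)
  push_cast at h1 h2
  linarith

/-- The extended statement IS a strengthening of the crux (instantiate `s = t/2`). -/
theorem uniformBoxCrossing_of_withoutFKG (h : UniformBoxCrossingWithoutFKG) : UniformBoxCrossing := by
  rw [uniformBoxCrossing_iff]
  intro ρ hρ
  obtain ⟨c, hc, n₀, hb⟩ := h ρ hρ
  exact ⟨c, hc, n₀, fun t => by rw [← extCornerPercolation_half_mul]; exact hb (half * t)⟩

end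

end Summit.CriticalPhenomena.CardyFormulaZ2.Cruxes.UniformBoxCrossing.Disproof
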